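import Literature.NumberTheory.Sieve.KloostermanQuadraticForms
import Literature.Analysis.FunctionSpaces.BesselJAnalyticProofs
import Mathlib.Analysis.SpecificLimits.Normed
import HarnessLib

/-!
# The large sieve inequality for Fourier coefficients of holomorphic cusp forms
# (Deshouillers–Iwaniec 1982, Theorem 2 (1.28), proof of §5.2)

We prove, for an ABSTRACT family of "holomorphic cusp forms of level `r`" — an index type `ι` with
weights `wt : ι → ℕ` and normalised Fourier coefficients `P : ι → ℕ → ℂ` about one cusp, of which
we assume nothing but PETERSSON'S FORMULA for that cusp (hypothesis `PeterssonFamily`, in the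
normalisation of the tree's Kuznetsov package `BFI.L1.KuzPlus`:
`4π Γ(k−1) ∑_{wt f = k} conj(P f m) P f n = δ_{mn} + 2π i^k ∑_{c ≡ 0 (r)} c⁻¹ S(m, n; c) J_{k−1}(4π√(mn)/c)`) —
the large sieve inequality of [DeshouillersIwaniec1982, Theorem 2 (1.28)]

  `∑_{wt f ≤ T} Γ(wt f) |∑_{N<n≤2N} a_n P f n|² ≤ K_ε (T² + N^{1+ε}/r) ‖a‖²`,

following the proof of [DeshouillersIwaniec1982, Proposition 4, §5.2 pp. 257–259]: Petersson's
formula is summed over the weights `k = 2l` against `(k−1)e^{−(k−1)/K}` (`K = T`), which produces on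
the diagonal `D_K = ∑ (2l−1)e^{−(2l−1)/K} ≍ K²` ((5.4)) and on the Kloosterman side the Neumann series
`E_K(x) = 2∑ (2l−1)(−1)^l e^{−(2l−1)/K} J_{2l−1}(x)`; the quadratic forms
`F(c, N) = ∑ ā_m a_n S(n, m; c) E_K(4π√(mn)/c)` are bounded by `≪ c^{−ε} N^{1+ε'} ‖a‖²` ((5.5)) by
means of Proposition 3 (the tree's `norm_quadB_le_weil`, `norm_quadB_le_largeSieve` and (1.27),
taken here as the input `ShortRange`).  For (5.5) the paper borrows from [Iwa2, Lemma 6] an integral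
representation of `E_K` through `J₀` and Poisson's integral; we use instead the equivalent and more
elementary route through BESSEL'S INTEGRAL (the tree's `integral_cexp_mul_sin_sub`):
`E_K(x)/2 = (2π)⁻¹ ∫₀^{2π} e^{ix sin θ} g(θ) dθ` with the closed form
`g(θ) = ∑ (2l−1)(−1)^l z^{2l−1} = −z(1−z²)/(1+z²)²`, `z = e^{−1/K−iθ}`, `g = i h'`,
`h = −z/(1+z²)`, `|h cos θ| ≤ 1/2`, `|g| ≤ e/(2cos²θ)`; the three ranges `F₁, F₂, F₃` of the paper
(p. 259) are then the partial integration by parts on `|θ ∓ π/2| ≤ Δ` (where `h` is large but the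
derivative of the phase carries the factor `cos θ`), its boundary terms, and the remaining range,
with the same choice `Δ = √(c/N)` for `c ≤ N` and a full integration by parts for `c > N`.

Main results: `PeterssonFamily` (the hypothesis), `largeSieve_hol_of_petersson` (the inequality,
with a constant depending on `ε` alone, uniformly in the level and the family).  The instances for
the cusps `∞` and `0` of `Γ₀(r)` and the tree's `BFI.L1.LSHolInf/LSHolZero` are one-liners from it
(file `DeshouillersIwaniecLargeSieveHolSpec.lean`).

## References
* [DeshouillersIwaniec1982] J.-M. Deshouillers, H. Iwaniec, *Kloosterman sums and Fourier coefficients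
  of cusp forms*, Invent. Math. 70 (1982), 219–288: Theorem 2 (1.28) p. 230; (4.4) p. 249; Proposition 4
  and its proof, §5.2 pp. 257–259 ((5.2)–(5.5)).
* [Watson1944] G. N. Watson, *A treatise on the theory of Bessel functions*, §2.2 (1) (Bessel's integral).
-/

noncomputable section

open Finset Real MeasureTheory Complex Set Filter intervalIntegral
open scoped ComplexConjugate ContDiff Topology

namespace Literature.NumberTheory.Sieve

namespace DeshouillersIwaniec

open BFI LargeSieve Literature.Analysis.FunctionSpaces

/-! ### The kernel on the Fourier side: `z = ρe^{−iθ}`, `h = −z/(1+z²)`, `g = −z(1−z²)/(1+z²)²` -/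

/-- `z = ρ e^{−iθ}`. [folklore] -/
def zK (ρ θ : ℝ) : ℂ := (ρ : ℂ) * Complex.exp (-I * θ)

/-- `h(θ) = −z/(1+z²) = ∑_{l ≥ 1} (−1)^l z^{2l−1}`. [folklore] -/
def hK (ρ θ : ℝ) : ℂ := -zK ρ θ / (1 + zK ρ θ ^ 2)

/-- `g(θ) = −z(1−z²)/(1+z²)² = ∑_{l ≥ 1} (2l−1)(−1)^l z^{2l−1}` (the Fourier side of `E_K/2`). [folklore] -/
def gK (ρ θ : ℝ) : ℂ := -zK ρ θ * (1 - zK ρ θ ^ 2) / (1 + zK ρ θ ^ 2) ^ 2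

/-- `‖z‖ = ρ` (`ρ ≥ 0`). [folklore] -/
theorem norm_zK {ρ : ℝ} (hρ : 0 ≤ ρ) (θ : ℝ) : ‖zK ρ θ‖ = ρ := by
  rw [zK, norm_mul, Complex.norm_real, Real.norm_eq_abs, abs_of_nonneg hρ, Complex.norm_exp]
  simp

/-- `z^n = ρ^n e^{−inθ}`. [folklore] -/
theorem zK_pow (ρ θ : ℝ) (n : ℕ) : zK ρ θ ^ n = (ρ : ℂ) ^ n * Complex.exp (-((n : ℂ) * θ * I)) := by
  rw [zK, mul_pow, ← Complex.exp_nat_mul]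
  congr 2
  ring

/-- `‖1 + z²‖² = (1 − ρ²)² + 4ρ² cos²θ`. [folklore] -/
theorem normSq_one_add_zK_sq (ρ θ : ℝ) : ‖1 + zK ρ θ ^ 2‖ ^ 2 = (1 - ρ ^ 2) ^ 2 + 4 * ρ ^ 2 * Real.cos θ ^ 2 := by
  have hz2 : zK ρ θ ^ 2 = ((ρ ^ 2 * Real.cos (2 * θ) : ℝ) : ℂ) + ((-(ρ ^ 2 * Real.sin (2 * θ)) : ℝ) : ℂ) * I := by
    rw [zK_pow, show -(((2 : ℕ) : ℂ) * θ * I) = ((-(2 * θ) : ℝ) : ℂ) * I by push_cast; ring, Complex.exp_mul_I]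
    push_cast
    rw [Complex.cos_neg, Complex.sin_neg, ← Complex.ofReal_ofNat, ← Complex.ofReal_mul, ← Complex.ofReal_cos,
      ← Complex.ofReal_sin]
    push_cast
    ring
  rw [hz2, Complex.sq_norm, Complex.normSq_apply]
  simp only [Complex.add_re, Complex.one_re, Complex.mul_re, Complex.ofReal_re, Complex.I_re, mul_zero,
    Complex.ofReal_im, Complex.I_im, sub_zero, Complex.add_im, Complex.one_im, Complex.mul_im,
    mul_one, add_zero, zero_add]
  rw [Real.cos_two_mul, Real.sin_two_mul]
  linear_combination (4 * ρ ^ 4 * Real.cos θ ^ 2) * Real.sin_sq_add_cos_sq θ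

/-- `2ρ|cos θ| ≤ ‖1 + z²‖`. [folklore] -/
theorem two_mul_abs_cos_le {ρ : ℝ} (hρ : 0 ≤ ρ) (θ : ℝ) : 2 * ρ * |Real.cos θ| ≤ ‖1 + zK ρ θ ^ 2‖ := by
  have h := normSq_one_add_zK_sq ρ θ
  have h1 : (2 * ρ * |Real.cos θ|) ^ 2 ≤ ‖1 + zK ρ θ ^ 2‖ ^ 2 := by
    rw [h, mul_pow, mul_pow, sq_abs]; nlinarith [sq_nonneg (1 - ρ ^ 2)]
  exact (pow_le_pow_iff_left₀ (by positivity) (norm_nonneg _) two_ne_zero).1 h1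

/-- `1 + z² ≠ 0` for `0 ≤ ρ < 1`. [folklore] -/
theorem one_add_zK_sq_ne_zero {ρ : ℝ} (hρ : 0 ≤ ρ) (hρ1 : ρ < 1) (θ : ℝ) : 1 + zK ρ θ ^ 2 ≠ 0 := by
  intro h
  have h1 : ‖zK ρ θ ^ 2‖ = 1 := by
    rw [show zK ρ θ ^ 2 = -1 from (neg_eq_of_add_eq_zero_right h).symm ▸ rfl]
    simp
  rw [norm_pow, norm_zK hρ] at h1
  nlinarith

/-- **`|h(θ) cos θ| ≤ 1/2`** (everywhere). [folklore] -/
theorem norm_hK_mul_abs_cos_le {ρ : ℝ} (hρ : 0 ≤ ρ) (θ : ℝ) : ‖hK ρ θ‖ * |Real.cos θ| ≤ 1 / 2 := by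
  rw [hK, norm_div, norm_neg, norm_zK hρ]
  by_cases h0 : ‖1 + zK ρ θ ^ 2‖ = 0
  · rw [h0, div_zero, zero_mul]; norm_num
  · have hpos : 0 < ‖1 + zK ρ θ ^ 2‖ := lt_of_le_of_ne (norm_nonneg _) (Ne.symm h0)
    rw [div_mul_eq_mul_div, div_le_iff₀ hpos]
    have := two_mul_abs_cos_le hρ θ
    linarith

/-- **`|h(θ)| ≤ 1/(2|cos θ|)`** (`cos θ ≠ 0`). [folklore] -/
theorem norm_hK_le {ρ : ℝ} (hρ : 0 ≤ ρ) {θ : ℝ} (hθ : Real.cos θ ≠ 0) : ‖hK ρ θ‖ ≤ 1 / (2 * |Real.cos θ|) := by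
  have hc : 0 < |Real.cos θ| := abs_pos.2 hθ
  rw [le_div_iff₀ (by positivity)]
  have := norm_hK_mul_abs_cos_le hρ θ
  linarith

/-- **`|g(θ)| ≤ 1/(2ρ cos²θ)`** (`0 < ρ ≤ 1`, `cos θ ≠ 0`). [folklore] -/
theorem norm_gK_le {ρ : ℝ} (hρ : 0 < ρ) (hρ1 : ρ ≤ 1) {θ : ℝ} (hθ : Real.cos θ ≠ 0) :
    ‖gK ρ θ‖ ≤ 1 / (2 * ρ * Real.cos θ ^ 2) := by
  have hc : 0 < |Real.cos θ| := abs_pos.2 hθ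
  have hden : 2 * ρ * |Real.cos θ| ≤ ‖1 + zK ρ θ ^ 2‖ := two_mul_abs_cos_le hρ.le θ
  have hdpos : 0 < ‖1 + zK ρ θ ^ 2‖ := lt_of_lt_of_le (by positivity) hden
  have hnum : ‖1 - zK ρ θ ^ 2‖ ≤ 2 := by
    calc ‖1 - zK ρ θ ^ 2‖ ≤ ‖(1 : ℂ)‖ + ‖zK ρ θ ^ 2‖ := norm_sub_le _ _
      _ = 1 + ρ ^ 2 := by rw [norm_one, norm_pow, norm_zK hρ.le]
      _ ≤ 2 := by nlinarith
  rw [gK, norm_div, norm_mul, norm_neg, norm_zK hρ.le, norm_pow]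
  rw [div_le_div_iff₀ (by positivity) (by positivity)]
  have hsq : (2 * ρ * |Real.cos θ|) ^ 2 ≤ ‖1 + zK ρ θ ^ 2‖ ^ 2 := pow_le_pow_left₀ (by positivity) hden 2
  rw [mul_pow, mul_pow, sq_abs] at hsq
  calc ρ * ‖1 - zK ρ θ ^ 2‖ * (2 * ρ * Real.cos θ ^ 2) ≤ ρ * 2 * (2 * ρ * Real.cos θ ^ 2) := by gcongr
    _ = 2 ^ 2 * ρ ^ 2 * Real.cos θ ^ 2 := by ring
    _ ≤ ‖1 + zK ρ θ ^ 2‖ ^ 2 := hsq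
    _ = 1 * ‖1 + zK ρ θ ^ 2‖ ^ 2 := (one_mul _).symm

/-- `z' = −iz`. [folklore] -/
theorem hasDerivAt_zK (ρ θ : ℝ) : HasDerivAt (zK ρ) (-I * zK ρ θ) θ := by
  have h0 : HasDerivAt (fun t : ℝ => -I * (t : ℂ)) (-I) θ := by
    simpa using (hasDerivAt_id θ).ofReal_comp.const_mul (-I)
  have h2 := (h0.cexp).const_mul (ρ : ℂ)
  refine h2.congr_deriv ?_
  simp only [zK]
  ring

/-- **`h' = −ig`**, i.e. `g = ih'`. [folklore] -/
theorem hasDerivAt_hK {ρ : ℝ} (hρ : 0 ≤ ρ) (hρ1 : ρ < 1) (θ : ℝ) : HasDerivAt (hK ρ) (-I * gK ρ θ) θ := by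
  have hz := hasDerivAt_zK ρ θ
  have hne := one_add_zK_sq_ne_zero hρ hρ1 θ
  have hnum : HasDerivAt (fun θ => -zK ρ θ) (-(-I * zK ρ θ)) θ := hz.neg
  have hden : HasDerivAt (fun θ => 1 + zK ρ θ ^ 2) (0 + (2 : ℕ) * zK ρ θ ^ (2 - 1) * (-I * zK ρ θ)) θ :=
    (hasDerivAt_const θ (1 : ℂ)).add (hz.pow 2)
  have h := hnum.div hden hne
  have hfun : hK ρ = ((fun θ => -zK ρ θ) / fun θ => 1 + zK ρ θ ^ 2) := by funext t; simp [hK]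
  rw [hfun]
  refine h.congr_deriv ?_
  rw [gK]
  field_simp
  push_cast
  simp only [pow_one]
  ring

/-- `h` is continuous. [folklore] -/
theorem continuous_hK {ρ : ℝ} (hρ : 0 ≤ ρ) (hρ1 : ρ < 1) : Continuous (hK ρ) :=
  continuous_iff_continuousAt.2 fun θ => (hasDerivAt_hK hρ hρ1 θ).continuousAt

/-- `z` is continuous in `θ`. [folklore] -/
theorem continuous_zK (ρ : ℝ) : Continuous (zK ρ) :=
  continuous_iff_continuousAt.2 fun θ => (hasDerivAt_zK ρ θ).continuousAt

/-- `g` is continuous. [folklore] -/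
theorem continuous_gK {ρ : ℝ} (hρ : 0 ≤ ρ) (hρ1 : ρ < 1) : Continuous (gK ρ) := by
  unfold gK
  refine Continuous.div (by have := continuous_zK ρ; fun_prop) (by have := continuous_zK ρ; fun_prop) fun θ => ?_
  exact pow_ne_zero 2 (one_add_zK_sq_ne_zero hρ hρ1 θ)

/-! ### The kernel as a power series: `∑ (2l−1)(−1)^l z^{2l−1}` -/

/-- For `‖w‖ < 1`: `∑_{j ≥ 0} (2j+1)(−1)^{j+1} w^{2j+1} = −w(1−w²)/(1+w²)²`. [folklore] -/
theorem hasSum_kernel {w : ℂ} (hw : ‖w‖ < 1) :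
    HasSum (fun j : ℕ => ((2 * j + 1 : ℕ) : ℂ) * (-1) ^ (j + 1) * w ^ (2 * j + 1))
      (-w * (1 - w ^ 2) / (1 + w ^ 2) ^ 2) := by
  set q : ℂ := -w ^ 2 with hq
  have hqn : ‖q‖ < 1 := by
    rw [hq, norm_neg, norm_pow]
    exact pow_lt_one₀ (norm_nonneg _) hw two_ne_zero
  have h1 : HasSum (fun j : ℕ => (j : ℂ) * q ^ j) (q / (1 - q) ^ 2) := hasSum_coe_mul_geometric_of_norm_lt_one hqn
  have h2 : HasSum (fun j : ℕ => q ^ j) (1 - q)⁻¹ := hasSum_geometric_of_norm_lt_one hqn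
  have h3 : HasSum (fun j : ℕ => -w * (2 * ((j : ℂ) * q ^ j) + q ^ j)) (-w * (2 * (q / (1 - q) ^ 2) + (1 - q)⁻¹)) :=
    ((h1.mul_left 2).add h2).mul_left (-w)
  have hq1 : (1 : ℂ) - q ≠ 0 := by
    intro h
    have : ‖q‖ = 1 := by rw [← sub_eq_zero.1 h]; simp
    linarith
  convert h3 using 1
  · funext j
    rw [hq]
    push_cast
    ring
  · have h' : (1 : ℂ) + w ^ 2 ≠ 0 := by rw [hq] at hq1; simpa using hq1
    rw [hq, sub_neg_eq_add]
    field_simp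
    ring

/-- The series for `g(θ)`: `∑_j (2j+1)(−1)^{j+1} z^{2j+1} = g(θ)` (`0 ≤ ρ < 1`). [folklore] -/
theorem hasSum_gK {ρ : ℝ} (hρ : 0 ≤ ρ) (hρ1 : ρ < 1) (θ : ℝ) :
    HasSum (fun j : ℕ => ((2 * j + 1 : ℕ) : ℂ) * (-1) ^ (j + 1) * zK ρ θ ^ (2 * j + 1)) (gK ρ θ) := by
  have h := hasSum_kernel (w := zK ρ θ) (by rw [norm_zK hρ]; exact hρ1)
  rwa [gK]

/-- The real series `∑_j (2j+1) ρ^{2j+1} = ρ(1+ρ²)/(1−ρ²)²` (`0 ≤ ρ < 1`): D–I's `D_K`, (5.4). [folklore] -/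
theorem hasSum_DK {ρ : ℝ} (hρ : 0 ≤ ρ) (hρ1 : ρ < 1) :
    HasSum (fun j : ℕ => ((2 * j + 1 : ℕ) : ℝ) * ρ ^ (2 * j + 1)) (ρ * (1 + ρ ^ 2) / (1 - ρ ^ 2) ^ 2) := by
  set q : ℝ := ρ ^ 2 with hq
  have hqn : ‖q‖ < 1 := by
    rw [hq, Real.norm_eq_abs, abs_of_nonneg (by positivity)]
    exact pow_lt_one₀ hρ hρ1 two_ne_zero
  have h1 : HasSum (fun j : ℕ => (j : ℝ) * q ^ j) (q / (1 - q) ^ 2) := hasSum_coe_mul_geometric_of_norm_lt_one hqn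
  have h2 : HasSum (fun j : ℕ => q ^ j) (1 - q)⁻¹ := hasSum_geometric_of_norm_lt_one hqn
  have h3 : HasSum (fun j : ℕ => ρ * (2 * ((j : ℝ) * q ^ j) + q ^ j)) (ρ * (2 * (q / (1 - q) ^ 2) + (1 - q)⁻¹)) :=
    ((h1.mul_left 2).add h2).mul_left ρ
  have hq1 : (1 : ℝ) - q ≠ 0 := by
    have : q < 1 := by simpa [Real.norm_eq_abs, abs_of_nonneg (show 0 ≤ q by positivity)] using hqn
    linarith
  convert h3 using 1
  · funext j
    rw [hq]
    push_cast
    ring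
  · rw [hq]
    field_simp
    ring

/-- **The diagonal factor**: `D(ρ) = ∑ (2j+1)ρ^{2j+1} ≤ 2/(1−ρ²)²`. [folklore] -/
theorem tsum_DK_le {ρ : ℝ} (hρ : 0 ≤ ρ) (hρ1 : ρ < 1) :
    Summable (fun j : ℕ => ((2 * j + 1 : ℕ) : ℝ) * ρ ^ (2 * j + 1)) ∧
      ∑' j : ℕ, ((2 * j + 1 : ℕ) : ℝ) * ρ ^ (2 * j + 1) ≤ 2 / (1 - ρ ^ 2) ^ 2 := by
  have h := hasSum_DK hρ hρ1
  refine ⟨h.summable, ?_⟩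
  rw [h.tsum_eq]
  have h1 : 0 < 1 - ρ ^ 2 := by nlinarith
  rw [div_le_div_iff_of_pos_right (by positivity)]
  nlinarith

/-- For `ρ = e^{−1/T}`, `T ≥ 1`: `1/(1−ρ²) ≤ 3T/2` (from `e^x ≥ 1 + x`). [folklore] -/
theorem inv_one_sub_sq_exp_le {T : ℝ} (hT : 1 ≤ T) : 1 / (1 - Real.exp (-1 / T) ^ 2) ≤ 3 * T / 2 := by
  have hT0 : 0 < T := by linarith
  have hx : Real.exp (-1 / T) ^ 2 = Real.exp (-(2 / T)) := by
    rw [← Real.exp_nat_mul]; congr 1; push_cast; ring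
  rw [hx]
  -- `1 - e^{-x} ≥ x/(1+x)` with `x = 2/T`
  have h1 : Real.exp (-(2 / T)) ≤ 1 / (1 + 2 / T) := by
    rw [Real.exp_neg, one_div]
    exact inv_anti₀ (by positivity) (by linarith [Real.add_one_le_exp (2 / T)])
  have h2 : 1 - Real.exp (-(2 / T)) ≥ (2 / T) / (1 + 2 / T) := by
    have : (2 / T) / (1 + 2 / T) = 1 - 1 / (1 + 2 / T) := by field_simp; ring
    linarith
  have h3 : 0 < (2 / T) / (1 + 2 / T) := by positivity
  calc 1 / (1 - Real.exp (-(2 / T))) ≤ 1 / ((2 / T) / (1 + 2 / T)) :=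
        one_div_le_one_div_of_le h3 h2
    _ = (T + 2) / 2 := by field_simp
    _ ≤ 3 * T / 2 := by linarith

/-! ### The Neumann series `E(ρ, x) = ∑ (2l−1)(−1)^l ρ^{2l−1} J_{2l−1}(x)` and Bessel's integral -/

/-- D–I's kernel `E_K(x)/2 = ∑_{l ≥ 1} (2l−1)(−1)^l e^{−(2l−1)/K} J_{2l−1}(x)` with `ρ = e^{−1/K}`
([DeshouillersIwaniec1982, (5.3)–(5.4)]; the tree's `besselJ`). [cite: DeshouillersIwaniec1982, §5.2 (5.3)] -/
def besselE (ρ x : ℝ) : ℝ := ∑' j : ℕ, ((2 * j + 1 : ℕ) : ℝ) * (-1) ^ (j + 1) * ρ ^ (2 * j + 1) * besselJ (2 * j + 1) x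

/-- The Neumann series converges absolutely (`|J_n| ≤ 1`). [folklore] -/
theorem hasSum_besselE {ρ : ℝ} (hρ : 0 ≤ ρ) (hρ1 : ρ < 1) (x : ℝ) :
    HasSum (fun j : ℕ => ((2 * j + 1 : ℕ) : ℝ) * (-1) ^ (j + 1) * ρ ^ (2 * j + 1) * besselJ (2 * j + 1) x) (besselE ρ x) := by
  refine (Summable.of_norm_bounded (tsum_DK_le hρ hρ1).1 fun j => ?_).hasSum
  rw [Real.norm_eq_abs, abs_mul, abs_mul, abs_mul, abs_pow, abs_neg, abs_one, one_pow, mul_one,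
    Nat.abs_cast, abs_pow, abs_of_nonneg hρ]
  exact mul_le_of_le_one_right (by positivity) (abs_besselJ_le_one_holds _ _)

/-- **Bessel's integral for the kernel**: `2π E(ρ, x) = ∫₀^{2π} e^{ix sin θ} g_ρ(θ) dθ`.
[cite: Watson1944, §2.2 (1)] -/
theorem integral_cexp_mul_gK {ρ : ℝ} (hρ : 0 ≤ ρ) (hρ1 : ρ < 1) (x : ℝ) :
    ∫ θ in (0 : ℝ)..2 * π, Complex.exp ((x : ℂ) * Real.sin θ * I) * gK ρ θ = 2 * π * (besselE ρ x : ℂ) := by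
  -- the terms
  set F : ℕ → ℝ → ℂ := fun j θ => Complex.exp ((x : ℂ) * Real.sin θ * I) *
    ((((2 * j + 1 : ℕ) : ℂ)) * (-1) ^ (j + 1) * zK ρ θ ^ (2 * j + 1)) with hF
  have hFint : ∀ j, ∫ θ in (0 : ℝ)..2 * π, F j θ =
      ((((2 * j + 1 : ℕ) : ℝ) * (-1) ^ (j + 1) * ρ ^ (2 * j + 1) * besselJ (2 * j + 1) x : ℝ) : ℂ) * (2 * π) := by
    intro j
    have h := integral_cexp_mul_sin_sub (2 * j + 1) x
    have hfun : F j = fun θ => ((((2 * j + 1 : ℕ) : ℂ)) * (-1) ^ (j + 1) * (ρ : ℂ) ^ (2 * j + 1)) *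
        (Complex.exp ((x : ℂ) * Real.sin θ * I) * Complex.exp (-(((2 * j + 1 : ℕ) : ℂ) * θ * I))) := by
      funext θ
      simp only [hF, zK_pow]
      ring
    rw [hfun, intervalIntegral.integral_const_mul, h]
    push_cast
    ring
  -- dominated convergence
  have hmeas : ∀ j, AEStronglyMeasurable (F j) (volume.restrict (Set.uIoc (0 : ℝ) (2 * π))) := by
    intro j
    refine (Continuous.aestronglyMeasurable ?_)
    simp only [hF]
    have := continuous_zK ρ
    fun_prop
  have hbound : ∀ j, ∀ᵐ θ ∂volume, θ ∈ Set.uIoc (0 : ℝ) (2 * π) → ‖F j θ‖ ≤ ((2 * j + 1 : ℕ) : ℝ) * ρ ^ (2 * j + 1) := by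
    intro j
    refine Eventually.of_forall fun θ _ => ?_
    simp only [hF, norm_mul, Complex.norm_exp, norm_pow, norm_neg, norm_one, one_pow, mul_one, Complex.norm_natCast,
      norm_zK hρ]
    have : ((x : ℂ) * Real.sin θ * I).re = 0 := by simp
    rw [this, Real.exp_zero, one_mul]
  have hsum : HasSum (fun j => ∫ θ in (0 : ℝ)..2 * π, F j θ)
      (∫ θ in (0 : ℝ)..2 * π, Complex.exp ((x : ℂ) * Real.sin θ * I) * gK ρ θ) := by
    refine intervalIntegral.hasSum_integral_of_dominated_convergence
      (fun j _ => ((2 * j + 1 : ℕ) : ℝ) * ρ ^ (2 * j + 1)) hmeas hbound ?_ ?_ ?_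
    · exact Eventually.of_forall fun θ _ => (tsum_DK_le hρ hρ1).1
    · exact intervalIntegrable_const
    · refine Eventually.of_forall fun θ _ => ?_
      simp only [hF]
      exact (hasSum_gK hρ hρ1 θ).mul_left _
  have hsum2 : HasSum (fun j => ∫ θ in (0 : ℝ)..2 * π, F j θ) ((besselE ρ x : ℂ) * (2 * π)) := by
    simp_rw [hFint]
    exact (Complex.hasSum_ofReal.2 (hasSum_besselE hρ hρ1 x)).mul_right _
  rw [hsum.unique hsum2]
  ring

/-! ### The quadratic forms `F(c) = ∑ ā_m a_n S(m,n;c) E(ρ, 4π√(mn)/c)` as an integral of `B(sin θ)` -/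

/-- `F(ρ, c, N, a) = ∑_{m,n ∼ N} ā_m a_n S(m, n; c) E(ρ, 4π√(mn)/c)` — D–I's `F_𝔞(c, N)/2` of p. 258
for the classical Kloosterman sum. [cite: DeshouillersIwaniec1982, §5.2 p. 258] -/
def formE (ρ : ℝ) (c : ℕ) (N : ℝ) (a : ℕ → ℂ) : ℂ :=
  ∑ m ∈ dyadic N, ∑ n ∈ dyadic N, conj (a m) * a n * kloo m n c * (besselE ρ (4 * π * Real.sqrt ((m : ℝ) * n) / c) : ℂ)

/-- The `θ`-family of quadratic forms `B(sin θ; c, N, b)` (the tree's `quadB`). [folklore] -/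
def Bq (c : ℕ) (N : ℝ) (b : ℕ → ℂ) (θ : ℝ) : ℂ := quadB (Real.sin θ) c N b

/-- `e(2 sin θ √(mn)/c) = exp(i (4π√(mn)/c) sin θ)`. [folklore] -/
theorem e_phase_eq (c : ℕ) (m n : ℕ) (θ : ℝ) :
    e (2 * Real.sin θ * Real.sqrt ((m : ℝ) * n) / c) =
      Complex.exp (((4 * π * Real.sqrt ((m : ℝ) * n) / c : ℝ) : ℂ) * Real.sin θ * I) := by
  rw [e_eq_exp]
  congr 1
  push_cast
  ring

/-- **`F` as an integral**: `2π F(ρ, c, N, a) = ∫₀^{2π} g_ρ(θ) B(sin θ; c, N, ā) dθ`. [cite: DeshouillersIwaniec1982, §5.2 p. 258] -/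
theorem formE_eq_integral {ρ : ℝ} (hρ : 0 ≤ ρ) (hρ1 : ρ < 1) (c : ℕ) (N : ℝ) (a : ℕ → ℂ) :
    2 * π * formE ρ c N a = ∫ θ in (0 : ℝ)..2 * π, gK ρ θ * Bq c N (fun n => conj (a n)) θ := by
  have hcont : ∀ m n : ℕ, Continuous fun θ : ℝ => gK ρ θ * (conj (a m) * a n * kloo m n c *
      Complex.exp (((4 * π * Real.sqrt ((m : ℝ) * n) / c : ℝ) : ℂ) * Real.sin θ * I)) := by
    intro m n
    have := continuous_gK hρ hρ1
    fun_prop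
  have hexp : ∀ θ : ℝ, gK ρ θ * Bq c N (fun n => conj (a n)) θ = ∑ m ∈ dyadic N, ∑ n ∈ dyadic N,
      gK ρ θ * (conj (a m) * a n * kloo m n c *
        Complex.exp (((4 * π * Real.sqrt ((m : ℝ) * n) / c : ℝ) : ℂ) * Real.sin θ * I)) := by
    intro θ
    simp only [Bq, quadB, Finset.mul_sum, e_phase_eq, Complex.conj_conj]
  simp_rw [hexp]
  rw [intervalIntegral.integral_finsetSum fun m _ =>
    (continuous_finsetSum _ fun n _ => hcont m n).intervalIntegrable _ _]
  rw [formE, Finset.mul_sum]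
  refine Finset.sum_congr rfl fun m _ => ?_
  rw [intervalIntegral.integral_finsetSum fun n _ => (hcont m n).intervalIntegrable _ _, Finset.mul_sum]
  refine Finset.sum_congr rfl fun n _ => ?_
  have h := integral_cexp_mul_gK hρ hρ1 (4 * π * Real.sqrt ((m : ℝ) * n) / c)
  calc 2 * π * (conj (a m) * a n * kloo m n c * (besselE ρ (4 * π * Real.sqrt ((m : ℝ) * n) / c) : ℂ))
      = conj (a m) * a n * kloo m n c * (2 * π * (besselE ρ (4 * π * Real.sqrt ((m : ℝ) * n) / c) : ℂ)) := by ring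
    _ = conj (a m) * a n * kloo m n c *
        ∫ θ in (0 : ℝ)..2 * π, Complex.exp (((4 * π * Real.sqrt ((m : ℝ) * n) / c : ℝ) : ℂ) * Real.sin θ * I) * gK ρ θ := by
        rw [← h]
    _ = _ := by
        rw [← intervalIntegral.integral_const_mul]
        refine intervalIntegral.integral_congr fun θ _ => ?_
        ring

/-! ### The derivative of `B(sin θ)` and the partial integration -/

/-- The rescaled sequence `b'_n = b_n √(n/N)` produced by differentiating the phase. [folklore] -/
def scaleSeq (N : ℝ) (b : ℕ → ℂ) (n : ℕ) : ℂ := b n * (Real.sqrt (n / N) : ℂ)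

/-- `‖b'‖² ≤ 2‖b‖²` (`n ≤ 2N` on the dyadic range). [folklore] -/
theorem l2_scaleSeq_le {N : ℝ} (hN : 0 < N) (b : ℕ → ℂ) : l2 N (scaleSeq N b) ≤ 2 * l2 N b := by
  rw [l2, l2, Finset.mul_sum]
  refine Finset.sum_le_sum fun n hn => ?_
  have h := ((mem_dyadic hN.le).1 hn).2
  rw [scaleSeq, norm_mul, mul_pow, Complex.norm_real, Real.norm_eq_abs, abs_of_nonneg (Real.sqrt_nonneg _),
    Real.sq_sqrt (by positivity)]
  have : (n : ℝ) / N ≤ 2 := by rw [div_le_iff₀ hN]; linarith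
  nlinarith [sq_nonneg ‖b n‖]

/-- `N √(m/N) √(n/N) = √(mn)` (`N > 0`). [folklore] -/
theorem mul_sqrt_div_mul_sqrt_div {N : ℝ} (hN : 0 < N) (m n : ℕ) :
    N * (Real.sqrt ((m : ℝ) / N) * Real.sqrt ((n : ℝ) / N)) = Real.sqrt ((m : ℝ) * n) := by
  rw [Real.sqrt_div (Nat.cast_nonneg _), Real.sqrt_div (Nat.cast_nonneg _), Real.sqrt_mul (Nat.cast_nonneg _)]
  have hs : Real.sqrt N ≠ 0 := (Real.sqrt_pos.2 hN).ne'
  field_simp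
  rw [Real.sq_sqrt hN.le]
  ring

/-- `B(sin θ; c, N, b)` as a double sum of exponentials. [folklore] -/
theorem Bq_eq (c : ℕ) (N : ℝ) (b : ℕ → ℂ) (θ : ℝ) :
    Bq c N b θ = ∑ m ∈ dyadic N, ∑ n ∈ dyadic N, b m * conj (b n) * kloo m n c *
      Complex.exp (((4 * π * Real.sqrt ((m : ℝ) * n) / c : ℝ) : ℂ) * Real.sin θ * I) := by
  simp only [Bq, quadB, e_phase_eq]

/-- **The `θ`-derivative of `B(sin θ; c, N, b)`** is `(4πN cos θ/c) i · B(sin θ; c, N, b')`. [folklore] -/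
theorem hasDerivAt_Bq (c : ℕ) {N : ℝ} (hN : 0 < N) (b : ℕ → ℂ) (θ : ℝ) :
    HasDerivAt (Bq c N b) ((((4 * π * N * Real.cos θ / c : ℝ) : ℂ) * I) * Bq c N (scaleSeq N b) θ) θ := by
  have hterm : ∀ m n : ℕ, HasDerivAt (fun θ : ℝ => b m * conj (b n) * kloo m n c *
      Complex.exp (((4 * π * Real.sqrt ((m : ℝ) * n) / c : ℝ) : ℂ) * Real.sin θ * I))
      (b m * conj (b n) * kloo m n c * (Complex.exp (((4 * π * Real.sqrt ((m : ℝ) * n) / c : ℝ) : ℂ) * Real.sin θ * I) *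
        ((((4 * π * Real.sqrt ((m : ℝ) * n) / c : ℝ) : ℂ) * Real.cos θ * I)))) θ := by
    intro m n
    have hs : HasDerivAt (fun θ : ℝ => ((Real.sin θ : ℝ) : ℂ)) ((Real.cos θ : ℝ) : ℂ) θ := (Real.hasDerivAt_sin θ).ofReal_comp
    have h1 : HasDerivAt (fun θ : ℝ => (((4 * π * Real.sqrt ((m : ℝ) * n) / c : ℝ) : ℂ) * Real.sin θ * I))
        ((((4 * π * Real.sqrt ((m : ℝ) * n) / c : ℝ) : ℂ) * Real.cos θ * I)) θ := by
      have := (hs.const_mul (((4 * π * Real.sqrt ((m : ℝ) * n) / c : ℝ) : ℂ))).mul_const I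
      simpa using this
    exact (h1.cexp).const_mul _
  have hsum := HasDerivAt.fun_sum (u := dyadic N) fun m _ => HasDerivAt.fun_sum (u := dyadic N) fun n _ => hterm m n
  have hfun : Bq c N b = fun θ => ∑ m ∈ dyadic N, ∑ n ∈ dyadic N, b m * conj (b n) * kloo m n c *
      Complex.exp (((4 * π * Real.sqrt ((m : ℝ) * n) / c : ℝ) : ℂ) * Real.sin θ * I) := by
    funext t; exact Bq_eq c N b t
  rw [hfun]
  refine hsum.congr_deriv ?_
  rw [Bq_eq, Finset.mul_sum]
  refine Finset.sum_congr rfl fun m _ => ?_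
  rw [Finset.mul_sum]
  refine Finset.sum_congr rfl fun n _ => ?_
  rw [← mul_sqrt_div_mul_sqrt_div hN m n]
  simp only [scaleSeq, map_mul, Complex.conj_ofReal]
  push_cast
  ring

/-- `B(sin θ; …)` is continuous in `θ`. [folklore] -/
theorem continuous_Bq (c : ℕ) {N : ℝ} (hN : 0 < N) (b : ℕ → ℂ) : Continuous (Bq c N b) :=
  continuous_iff_continuousAt.2 fun θ => (hasDerivAt_Bq c hN b θ).continuousAt

/-- **Partial integration** ([DeshouillersIwaniec1982, p. 258, the rearrangement of the Poisson integral],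
here on the Fourier side): `∫_α^β g B = i [h B]_α^β − i ∫_α^β h · (4πN cos θ/c) i B'`.
[cite: DeshouillersIwaniec1982, §5.2 p. 258] -/
theorem integral_gK_mul_Bq {ρ : ℝ} (hρ : 0 ≤ ρ) (hρ1 : ρ < 1) (c : ℕ) {N : ℝ} (hN : 0 < N) (b : ℕ → ℂ) (α β : ℝ) :
    ∫ θ in α..β, gK ρ θ * Bq c N b θ =
      I * (hK ρ β * Bq c N b β - hK ρ α * Bq c N b α) -
        I * ∫ θ in α..β, hK ρ θ * ((((4 * π * N * Real.cos θ / c : ℝ) : ℂ) * I) * Bq c N (scaleSeq N b) θ) := by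
  have hu : ∀ θ ∈ uIcc α β, HasDerivAt (hK ρ) (-I * gK ρ θ) θ := fun θ _ => hasDerivAt_hK hρ hρ1 θ
  have hv : ∀ θ ∈ uIcc α β, HasDerivAt (Bq c N b)
      ((((4 * π * N * Real.cos θ / c : ℝ) : ℂ) * I) * Bq c N (scaleSeq N b) θ) θ := fun θ _ => hasDerivAt_Bq c hN b θ
  have hcu : Continuous fun θ => -I * gK ρ θ := continuous_const.mul (continuous_gK hρ hρ1)
  have hcv : Continuous fun θ => (((4 * π * N * Real.cos θ / c : ℝ) : ℂ) * I) * Bq c N (scaleSeq N b) θ := by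
    have := continuous_Bq c hN (scaleSeq N b)
    fun_prop
  have hibp := intervalIntegral.integral_mul_deriv_eq_deriv_mul hu hv (hcu.intervalIntegrable _ _)
    (hcv.intervalIntegrable _ _)
  have h2 : ∫ θ in α..β, -I * gK ρ θ * Bq c N b θ = -I * ∫ θ in α..β, gK ρ θ * Bq c N b θ := by
    rw [← intervalIntegral.integral_const_mul]
    refine intervalIntegral.integral_congr fun θ _ => ?_
    ring
  rw [h2] at hibp
  linear_combination I * hibp + (∫ θ in α..β, gK ρ θ * Bq c N b θ) * Complex.I_sq

/-! ### The three ranges of the `θ`-integral ([DeshouillersIwaniec1982, p. 259, `F₁, F₂, F₃`]) -/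

/-- The integrand of the partial-integration term is at most `(2πN/c)‖B(sin θ; b')‖` (`|h cos θ| ≤ 1/2`).
[folklore] -/
theorem norm_hK_mul_deriv_le {ρ : ℝ} (hρ : 0 ≤ ρ) (c : ℕ) {N : ℝ} (hN : 0 ≤ N) (b : ℕ → ℂ) (θ : ℝ) :
    ‖hK ρ θ * ((((4 * π * N * Real.cos θ / c : ℝ) : ℂ) * I) * Bq c N (scaleSeq N b) θ)‖ ≤
      2 * π * N / c * ‖Bq c N (scaleSeq N b) θ‖ := by
  rw [norm_mul, norm_mul, norm_mul, Complex.norm_I, mul_one, Complex.norm_real, Real.norm_eq_abs]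
  rw [show |4 * π * N * Real.cos θ / c| = 4 * π * N / c * |Real.cos θ| by
    rw [abs_div, abs_mul, abs_of_nonneg (by positivity : 0 ≤ 4 * π * N), Nat.abs_cast]; ring]
  have h := norm_hK_mul_abs_cos_le hρ θ
  calc ‖hK ρ θ‖ * (4 * π * N / c * |Real.cos θ| * ‖Bq c N (scaleSeq N b) θ‖)
      = (4 * π * N / c) * (‖hK ρ θ‖ * |Real.cos θ|) * ‖Bq c N (scaleSeq N b) θ‖ := by ring
    _ ≤ (4 * π * N / c) * (1 / 2) * ‖Bq c N (scaleSeq N b) θ‖ := by gcongr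
    _ = _ := by ring

/-- **Ranges `F₁` and `F₃`** (partial integration near `θ = π/2, 3π/2`, with its boundary terms): for
`α ≤ β` and `‖B(sin θ; b')‖ ≤ M` on `[α, β]`,
`‖∫_α^β g B‖ ≤ ‖h(β)‖‖B(β)‖ + ‖h(α)‖‖B(α)‖ + (2πN/c)(β − α) M`. [cite: DeshouillersIwaniec1982, §5.2 p. 259] -/
theorem norm_integral_formB {ρ : ℝ} (hρ : 0 ≤ ρ) (hρ1 : ρ < 1) (c : ℕ) {N : ℝ} (hN : 0 < N) (b : ℕ → ℂ)
    {α β : ℝ} (hαβ : α ≤ β) {M : ℝ} (hM : ∀ θ ∈ Icc α β, ‖Bq c N (scaleSeq N b) θ‖ ≤ M) :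
    ‖∫ θ in α..β, gK ρ θ * Bq c N b θ‖ ≤
      ‖hK ρ β‖ * ‖Bq c N b β‖ + ‖hK ρ α‖ * ‖Bq c N b α‖ + 2 * π * N / c * (β - α) * M := by
  rw [integral_gK_mul_Bq hρ hρ1 c hN b α β]
  have hint : ‖∫ θ in α..β, hK ρ θ * ((((4 * π * N * Real.cos θ / c : ℝ) : ℂ) * I) * Bq c N (scaleSeq N b) θ)‖ ≤
      2 * π * N / c * M * |β - α| := by
    refine intervalIntegral.norm_integral_le_of_norm_le_const fun θ hθ => ?_
    rw [Set.uIoc_of_le hαβ] at hθ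
    refine (norm_hK_mul_deriv_le hρ c hN.le b θ).trans ?_
    exact mul_le_mul_of_nonneg_left (hM θ ⟨hθ.1.le, hθ.2⟩) (by positivity)
  rw [abs_of_nonneg (by linarith)] at hint
  calc ‖I * (hK ρ β * Bq c N b β - hK ρ α * Bq c N b α) -
        I * ∫ θ in α..β, hK ρ θ * ((((4 * π * N * Real.cos θ / c : ℝ) : ℂ) * I) * Bq c N (scaleSeq N b) θ)‖
      ≤ ‖I * (hK ρ β * Bq c N b β - hK ρ α * Bq c N b α)‖ +
        ‖I * ∫ θ in α..β, hK ρ θ * ((((4 * π * N * Real.cos θ / c : ℝ) : ℂ) * I) * Bq c N (scaleSeq N b) θ)‖ :=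
        norm_sub_le _ _
    _ ≤ (‖hK ρ β‖ * ‖Bq c N b β‖ + ‖hK ρ α‖ * ‖Bq c N b α‖) + 2 * π * N / c * M * (β - α) := by
        rw [norm_mul, Complex.norm_I, one_mul, norm_mul, Complex.norm_I, one_mul]
        refine add_le_add ((norm_sub_le _ _).trans (by rw [norm_mul, norm_mul])) hint
    _ = _ := by ring

/-- `z`, hence `h`, is `2π`-periodic. [folklore] -/
theorem hK_two_pi (ρ : ℝ) : hK ρ (2 * π) = hK ρ 0 := by
  have : zK ρ (2 * π) = zK ρ 0 := by
    simp only [zK]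
    push_cast
    rw [show -I * (2 * (π : ℂ)) = -(2 * π * I) by ring, Complex.exp_neg, Complex.exp_two_pi_mul_I]
    simp
  simp [hK, this]

/-- `B(sin 2π) = B(sin 0)`. [folklore] -/
theorem Bq_two_pi (c : ℕ) (N : ℝ) (b : ℕ → ℂ) : Bq c N b (2 * π) = Bq c N b 0 := by
  simp [Bq, Real.sin_two_pi]

/-- **The full period** (the range `c > N`: one integration by parts, no boundary terms):
`‖∫₀^{2π} g B‖ ≤ (2πN/c) · 2π · sup ‖B(sin θ; b')‖`. [cite: DeshouillersIwaniec1982, §5.2 p. 259] -/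
theorem norm_integral_period {ρ : ℝ} (hρ : 0 ≤ ρ) (hρ1 : ρ < 1) (c : ℕ) {N : ℝ} (hN : 0 < N) (b : ℕ → ℂ)
    {M : ℝ} (hM : ∀ θ, ‖Bq c N (scaleSeq N b) θ‖ ≤ M) :
    ‖∫ θ in (0 : ℝ)..2 * π, gK ρ θ * Bq c N b θ‖ ≤ 2 * π * N / c * (2 * π) * M := by
  rw [integral_gK_mul_Bq hρ hρ1 c hN b 0 (2 * π), hK_two_pi, Bq_two_pi, sub_self, mul_zero, zero_sub, norm_neg,
    norm_mul, Complex.norm_I, one_mul]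
  have hint := intervalIntegral.norm_integral_le_of_norm_le_const (a := (0 : ℝ)) (b := 2 * π)
    (f := fun θ => hK ρ θ * ((((4 * π * N * Real.cos θ / c : ℝ) : ℂ) * I) * Bq c N (scaleSeq N b) θ))
    (C := 2 * π * N / c * M) fun θ _ =>
      (norm_hK_mul_deriv_le hρ c hN.le b θ).trans (mul_le_mul_of_nonneg_left (hM θ) (by positivity))
  rw [sub_zero, abs_of_nonneg (by positivity)] at hint
  linarith

/-- **Range `F₂`** (away from `θ = π/2, 3π/2`, no integration by parts): if `cos θ ≠ 0` on `[α, β]`,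
`‖B(sin θ)‖ ≤ M₁` whenever `|sin θ| ≥ 1/2` and `‖B(sin θ)‖ ≤ M₂` always, then
`‖∫_α^β g B‖ ≤ (e/2) M₁ (tan β − tan α) + (2e/3) M₂ (β − α)` (`e^{−1} ≤ ρ < 1`; `|g| ≤ e/(2cos²θ)`, and
`cos²θ > 3/4` where `|sin θ| < 1/2`). [cite: DeshouillersIwaniec1982, §5.2 p. 259] -/
theorem norm_integral_formA {ρ : ℝ} (hρ : Real.exp (-1) ≤ ρ) (hρ1 : ρ < 1) (c : ℕ) (N : ℝ) (b : ℕ → ℂ)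
    {α β : ℝ} (hαβ : α ≤ β) (hcos : ∀ θ ∈ Icc α β, Real.cos θ ≠ 0) {M₁ M₂ : ℝ} (hM₁ : 0 ≤ M₁) (hM₂ : 0 ≤ M₂)
    (h1 : ∀ θ ∈ Icc α β, 1 / 2 ≤ |Real.sin θ| → ‖Bq c N b θ‖ ≤ M₁) (h2 : ∀ θ ∈ Icc α β, ‖Bq c N b θ‖ ≤ M₂) :
    ‖∫ θ in α..β, gK ρ θ * Bq c N b θ‖ ≤
      Real.exp 1 / 2 * M₁ * (Real.tan β - Real.tan α) + 2 * Real.exp 1 / 3 * M₂ * (β - α) := by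
  have hρ0 : 0 < ρ := lt_of_lt_of_le (Real.exp_pos _) hρ
  have hρinv : 1 / ρ ≤ Real.exp 1 := by
    rw [div_le_iff₀ hρ0]
    calc (1 : ℝ) = Real.exp 1 * Real.exp (-1) := by rw [← Real.exp_add]; norm_num
      _ ≤ Real.exp 1 * ρ := by gcongr
  -- pointwise bound
  have hpt : ∀ θ ∈ Icc α β, ‖gK ρ θ * Bq c N b θ‖ ≤
      Real.exp 1 / 2 * M₁ * (1 / Real.cos θ ^ 2) + 2 * Real.exp 1 / 3 * M₂ := by
    intro θ hθ
    have hc := hcos θ hθ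
    have hc2 : 0 < Real.cos θ ^ 2 := by positivity
    have hg : ‖gK ρ θ‖ ≤ Real.exp 1 / 2 * (1 / Real.cos θ ^ 2) := by
      refine (norm_gK_le hρ0 hρ1.le hc).trans ?_
      rw [show 1 / (2 * ρ * Real.cos θ ^ 2) = (1 / ρ) / 2 * (1 / Real.cos θ ^ 2) by field_simp]
      gcongr
    rw [norm_mul]
    by_cases hs : 1 / 2 ≤ |Real.sin θ|
    · calc ‖gK ρ θ‖ * ‖Bq c N b θ‖ ≤ Real.exp 1 / 2 * (1 / Real.cos θ ^ 2) * M₁ :=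
            mul_le_mul hg (h1 θ hθ hs) (norm_nonneg _) (by positivity)
        _ = Real.exp 1 / 2 * M₁ * (1 / Real.cos θ ^ 2) := by ring
        _ ≤ _ := le_add_of_nonneg_right (by positivity)
    · push Not at hs
      have hcos2 : 3 / 4 ≤ Real.cos θ ^ 2 := by
        have h3 := Real.sin_sq_add_cos_sq θ
        have h4 : Real.sin θ ^ 2 < 1 / 4 := by
          calc Real.sin θ ^ 2 = |Real.sin θ| ^ 2 := (sq_abs _).symm
            _ < (1 / 2) ^ 2 := pow_lt_pow_left₀ hs (abs_nonneg _) two_ne_zero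
            _ = 1 / 4 := by norm_num
        linarith
      have hg' : ‖gK ρ θ‖ ≤ 2 * Real.exp 1 / 3 := by
        refine hg.trans ?_
        rw [show 2 * Real.exp 1 / 3 = Real.exp 1 / 2 * (1 / (3 / 4)) by ring]
        gcongr
      calc ‖gK ρ θ‖ * ‖Bq c N b θ‖ ≤ 2 * Real.exp 1 / 3 * M₂ := mul_le_mul hg' (h2 θ hθ) (norm_nonneg _) (by positivity)
        _ ≤ _ := le_add_of_nonneg_left (by positivity)
  -- integrate
  have hcont : ContinuousOn (fun θ => 1 / Real.cos θ ^ 2) (uIcc α β) := by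
    rw [Set.uIcc_of_le hαβ]
    exact continuousOn_const.div ((Real.continuous_cos.pow 2).continuousOn) fun θ hθ => pow_ne_zero 2 (hcos θ hθ)
  have htan : ∫ θ in α..β, 1 / Real.cos θ ^ 2 = Real.tan β - Real.tan α := by
    refine intervalIntegral.integral_eq_sub_of_hasDerivAt (fun θ hθ => Real.hasDerivAt_tan (hcos θ ?_))
      hcont.intervalIntegrable
    rwa [Set.uIcc_of_le hαβ] at hθ
  have hf1 : IntervalIntegrable (fun θ => Real.exp 1 / 2 * M₁ * (1 / Real.cos θ ^ 2)) volume α β :=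
    hcont.intervalIntegrable.const_mul _
  have hgint : IntervalIntegrable (fun θ => Real.exp 1 / 2 * M₁ * (1 / Real.cos θ ^ 2) + 2 * Real.exp 1 / 3 * M₂) volume α β :=
    hf1.add intervalIntegrable_const
  calc ‖∫ θ in α..β, gK ρ θ * Bq c N b θ‖
      ≤ ∫ θ in α..β, (Real.exp 1 / 2 * M₁ * (1 / Real.cos θ ^ 2) + 2 * Real.exp 1 / 3 * M₂) := by
        refine intervalIntegral.norm_integral_le_of_norm_le hαβ ?_ hgint
        exact Eventually.of_forall fun θ hθ => hpt θ ⟨hθ.1.le, hθ.2⟩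
    _ = Real.exp 1 / 2 * M₁ * (Real.tan β - Real.tan α) + 2 * Real.exp 1 / 3 * M₂ * (β - α) := by
        rw [intervalIntegral.integral_add hf1 intervalIntegrable_const, intervalIntegral.integral_const_mul, htan,
          intervalIntegral.integral_const, smul_eq_mul]
        ring

/-! ### Elementary trigonometry of the partition `θ = π/2 ± Δ, 3π/2 ± Δ` -/

/-- `cos t ≥ sin Δ` for `|t| ≤ π/2 − Δ` (`0 ≤ Δ`). [folklore] -/
theorem sin_le_cos_of_abs_le {Δ t : ℝ} (hΔ : 0 ≤ Δ) (ht : |t| ≤ π / 2 - Δ) : Real.sin Δ ≤ Real.cos t := by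
  rw [← Real.cos_abs, ← Real.cos_pi_div_two_sub]
  exact Real.cos_le_cos_of_nonneg_of_le_pi (abs_nonneg t) (by linarith [Real.pi_pos]) ht

/-- `cos t ≥ cos Δ` for `|t| ≤ Δ ≤ π`. [folklore] -/
theorem cos_le_cos_of_abs_le {Δ t : ℝ} (hΔ : Δ ≤ π) (ht : |t| ≤ Δ) : Real.cos Δ ≤ Real.cos t := by
  rw [← Real.cos_abs (x := t)]
  exact Real.cos_le_cos_of_nonneg_of_le_pi (abs_nonneg t) hΔ ht

/-- Jordan: `sin Δ ≥ (2/π)Δ` and hence `1/(2 sin Δ) ≤ π/(4Δ)` for `0 < Δ ≤ 1`. [folklore] -/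
theorem inv_two_sin_le {Δ : ℝ} (hΔ : 0 < Δ) (hΔ1 : Δ ≤ 1) : 1 / (2 * Real.sin Δ) ≤ π / (4 * Δ) := by
  have hπ := Real.pi_gt_three
  have hs : 2 / π * Δ ≤ Real.sin Δ := Real.mul_le_sin hΔ.le (by linarith)
  have hs0 : 0 < 2 / π * Δ := by positivity
  calc 1 / (2 * Real.sin Δ) ≤ 1 / (2 * (2 / π * Δ)) := by
        apply one_div_le_one_div_of_le (by positivity); linarith
    _ = π / (4 * Δ) := by field_simp; ring

/-- `cos Δ ≥ 1/2` for `0 ≤ Δ ≤ 1`. [folklore] -/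
theorem half_le_cos {Δ : ℝ} (hΔ : 0 ≤ Δ) (hΔ1 : Δ ≤ 1) : 1 / 2 ≤ Real.cos Δ := by
  have := Real.one_sub_sq_div_two_le_cos (x := Δ)
  nlinarith

/-- `cot Δ = tan(π/2 − Δ) ≤ 1/Δ` for `0 < Δ ≤ 1`. [folklore] -/
theorem tan_pi_div_two_sub_le {Δ : ℝ} (hΔ : 0 < Δ) (hΔ1 : Δ ≤ 1) : Real.tan (π / 2 - Δ) ≤ 1 / Δ := by
  rw [Real.tan_pi_div_two_sub, ← one_div]
  have hπ := Real.pi_gt_three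
  exact one_div_le_one_div_of_le hΔ (Real.le_tan hΔ.le (by linarith))

/-- `tan(π/2 + Δ) = −tan(π/2 − Δ)`. [folklore] -/
theorem tan_pi_div_two_add (Δ : ℝ) : Real.tan (π / 2 + Δ) = -Real.tan (π / 2 - Δ) := by
  rw [show π / 2 + Δ = π / 2 - (-Δ) by ring, Real.tan_pi_div_two_sub, Real.tan_pi_div_two_sub, Real.tan_neg, inv_neg]

/-- The values of `tan` at the partition points. [folklore] -/
theorem tan_partition (Δ : ℝ) :
    Real.tan (3 * π / 2 - Δ) = Real.tan (π / 2 - Δ) ∧ Real.tan (3 * π / 2 + Δ) = -Real.tan (π / 2 - Δ) ∧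
      Real.tan (2 * π) = 0 ∧ Real.tan 0 = 0 := by
  refine ⟨?_, ?_, ?_, Real.tan_zero⟩
  · rw [show 3 * π / 2 - Δ = π / 2 - Δ + π by ring, Real.tan_add_pi]
  · rw [show 3 * π / 2 + Δ = π / 2 + Δ + π by ring, Real.tan_add_pi, tan_pi_div_two_add]
  · exact_mod_cast Real.tan_nat_mul_pi 2

/-- **The `θ`-integral over a period, split at `π/2 ± Δ`, `3π/2 ± Δ`** ([DeshouillersIwaniec1982, p. 259]:
`F = F₁ + F₂ + F₃`): with `M₁ ≥ ‖B(sin θ; b)‖` and `M₁' ≥ ‖B(sin θ; b')‖` for `|sin θ| ≥ 1/2`, and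
`M₂ ≥ ‖B(sin θ; b)‖` always,
`‖∫₀^{2π} g B‖ ≤ 2e M₁/Δ + (4πe/3) M₂ + π M₁/Δ + (8πN/c) Δ M₁'` (`0 < Δ ≤ 1`, `e⁻¹ ≤ ρ < 1`).
[cite: DeshouillersIwaniec1982, §5.2 p. 259] -/
theorem norm_integral_two_pi_le {ρ : ℝ} (hρ : Real.exp (-1) ≤ ρ) (hρ1 : ρ < 1) (c : ℕ) {N : ℝ} (hN : 0 < N)
    (b : ℕ → ℂ) {Δ : ℝ} (hΔ : 0 < Δ) (hΔ1 : Δ ≤ 1) {M₁ M₁' M₂ : ℝ} (hM₁ : 0 ≤ M₁) (hM₂ : 0 ≤ M₂)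
    (h1 : ∀ θ, 1 / 2 ≤ |Real.sin θ| → ‖Bq c N b θ‖ ≤ M₁)
    (h1' : ∀ θ, 1 / 2 ≤ |Real.sin θ| → ‖Bq c N (scaleSeq N b) θ‖ ≤ M₁')
    (h2 : ∀ θ, ‖Bq c N b θ‖ ≤ M₂) :
    ‖∫ θ in (0 : ℝ)..2 * π, gK ρ θ * Bq c N b θ‖ ≤
      2 * Real.exp 1 * M₁ / Δ + 4 * π * Real.exp 1 / 3 * M₂ + (π * M₁ / Δ + 8 * π * N / c * Δ * M₁') := by
  have hπ := Real.pi_gt_three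
  have hρ0 : 0 ≤ ρ := (Real.exp_pos _).le.trans hρ
  set θ₁ : ℝ := π / 2 - Δ with hθ₁
  set θ₂ : ℝ := π / 2 + Δ with hθ₂
  set θ₃ : ℝ := 3 * π / 2 - Δ with hθ₃
  set θ₄ : ℝ := 3 * π / 2 + Δ with hθ₄
  have h01 : 0 ≤ θ₁ := by rw [hθ₁]; linarith
  have h12 : θ₁ ≤ θ₂ := by rw [hθ₁, hθ₂]; linarith
  have h23 : θ₂ ≤ θ₃ := by rw [hθ₂, hθ₃]; linarith
  have h34 : θ₃ ≤ θ₄ := by rw [hθ₃, hθ₄]; linarith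
  have h45 : θ₄ ≤ 2 * π := by rw [hθ₄]; linarith
  -- the integrand is continuous
  have hcont : Continuous fun θ => gK ρ θ * Bq c N b θ := (continuous_gK hρ0 hρ1).mul (continuous_Bq c hN b)
  have hii : ∀ a b' : ℝ, IntervalIntegrable (fun θ => gK ρ θ * Bq c N b θ) volume a b' := fun a b' =>
    hcont.intervalIntegrable _ _
  -- trigonometric facts
  have hsinΔ : 1 / (2 * Real.sin Δ) ≤ π / (4 * Δ) := inv_two_sin_le hΔ hΔ1
  have hcosΔ : 1 / 2 ≤ Real.cos Δ := half_le_cos hΔ.le hΔ1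
  have hcotΔ : Real.tan (π / 2 - Δ) ≤ 1 / Δ := tan_pi_div_two_sub_le hΔ hΔ1
  obtain ⟨ht3, ht4, ht2π, ht0⟩ := tan_partition Δ
  have hsinpos : 0 < Real.sin Δ := Real.sin_pos_of_pos_of_lt_pi hΔ (by linarith)
  -- `cos` on the three outer ranges, `|sin|` on the two inner ones and at their endpoints
  have hcosA1 : ∀ θ ∈ Icc 0 θ₁, Real.sin Δ ≤ Real.cos θ := fun θ hθ =>
    sin_le_cos_of_abs_le hΔ.le (by rw [abs_of_nonneg hθ.1]; exact hθ.2)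
  have hcosA2 : ∀ θ ∈ Icc θ₂ θ₃, Real.cos θ ≤ -Real.sin Δ := by
    intro θ hθ
    have h := sin_le_cos_of_abs_le hΔ.le (t := θ - π) (by rw [abs_le]; constructor <;> [rw [hθ₂] at hθ; rw [hθ₃] at hθ] <;> linarith [hθ.1, hθ.2])
    rw [Real.cos_sub_pi] at h
    linarith
  have hcosA3 : ∀ θ ∈ Icc θ₄ (2 * π), Real.sin Δ ≤ Real.cos θ := by
    intro θ hθ
    have h := sin_le_cos_of_abs_le hΔ.le (t := θ - 2 * π) (by rw [abs_le]; rw [hθ₄] at hθ; constructor <;> linarith [hθ.1, hθ.2])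
    rwa [Real.cos_sub_two_pi] at h
  have hsinB1 : ∀ θ ∈ Icc θ₁ θ₂, 1 / 2 ≤ |Real.sin θ| := by
    intro θ hθ
    have h := cos_le_cos_of_abs_le (by linarith : Δ ≤ π) (t := θ - π / 2) (by rw [abs_le]; rw [hθ₁, hθ₂] at hθ; constructor <;> linarith [hθ.1, hθ.2])
    rw [Real.cos_sub_pi_div_two] at h
    exact le_trans (hcosΔ.trans h) (le_abs_self _)
  have hsinB2 : ∀ θ ∈ Icc θ₃ θ₄, 1 / 2 ≤ |Real.sin θ| := by
    intro θ hθ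
    have h := cos_le_cos_of_abs_le (by linarith : Δ ≤ π) (t := θ - 3 * π / 2) (by rw [abs_le]; rw [hθ₃, hθ₄] at hθ; constructor <;> linarith [hθ.1, hθ.2])
    have : Real.cos (θ - 3 * π / 2) = -Real.sin θ := by
      rw [show θ - 3 * π / 2 = θ - π / 2 - π by ring, Real.cos_sub_pi, Real.cos_sub_pi_div_two]
    rw [this] at h
    exact le_trans (hcosΔ.trans h) (neg_le_abs _)
  -- the values of `|cos|` at the four partition points
  have hcos_end : ∀ θ ∈ ({θ₁, θ₂, θ₃, θ₄} : Set ℝ), |Real.cos θ| = Real.sin Δ := by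
    intro θ hθ
    simp only [Set.mem_insert_iff, Set.mem_singleton_iff] at hθ
    rcases hθ with rfl | rfl | rfl | rfl
    · rw [hθ₁, Real.cos_pi_div_two_sub, abs_of_pos hsinpos]
    · rw [hθ₂, show π / 2 + Δ = Δ + π / 2 by ring, Real.cos_add_pi_div_two, abs_neg, abs_of_pos hsinpos]
    · rw [hθ₃, show 3 * π / 2 - Δ = (π / 2 - Δ) + π by ring, Real.cos_add_pi, Real.cos_pi_div_two_sub, abs_neg,
        abs_of_pos hsinpos]
    · rw [hθ₄, show 3 * π / 2 + Δ = (Δ + π / 2) + π by ring, Real.cos_add_pi, Real.cos_add_pi_div_two, neg_neg,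
        abs_of_pos hsinpos]
  have hh_end : ∀ θ ∈ ({θ₁, θ₂, θ₃, θ₄} : Set ℝ), ‖hK ρ θ‖ ≤ π / (4 * Δ) := by
    intro θ hθ
    have hc := hcos_end θ hθ
    have hne : Real.cos θ ≠ 0 := fun h0 => by rw [h0, abs_zero] at hc; linarith
    refine (norm_hK_le hρ0 hne).trans ?_
    rwa [hc]
  have hB_end : ∀ θ ∈ ({θ₁, θ₂, θ₃, θ₄} : Set ℝ), ‖Bq c N b θ‖ ≤ M₁ := by
    intro θ hθ
    refine h1 θ ?_
    simp only [Set.mem_insert_iff, Set.mem_singleton_iff] at hθ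
    rcases hθ with rfl | rfl | rfl | rfl
    · exact hsinB1 _ ⟨le_rfl, h12⟩
    · exact hsinB1 _ ⟨h12, le_rfl⟩
    · exact hsinB2 _ ⟨le_rfl, h34⟩
    · exact hsinB2 _ ⟨h34, le_rfl⟩
  -- the five pieces
  have hA1 : ‖∫ θ in (0 : ℝ)..θ₁, gK ρ θ * Bq c N b θ‖ ≤
      Real.exp 1 / 2 * M₁ * (Real.tan θ₁ - Real.tan 0) + 2 * Real.exp 1 / 3 * M₂ * (θ₁ - 0) :=
    norm_integral_formA hρ hρ1 c N b h01 (fun θ hθ => (hsinpos.trans_le (hcosA1 θ hθ)).ne') hM₁ hM₂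
      (fun θ _ hs => h1 θ hs) (fun θ _ => h2 θ)
  have hA2 : ‖∫ θ in θ₂..θ₃, gK ρ θ * Bq c N b θ‖ ≤
      Real.exp 1 / 2 * M₁ * (Real.tan θ₃ - Real.tan θ₂) + 2 * Real.exp 1 / 3 * M₂ * (θ₃ - θ₂) :=
    norm_integral_formA hρ hρ1 c N b h23 (fun θ hθ => (lt_of_le_of_lt (hcosA2 θ hθ) (by linarith)).ne) hM₁ hM₂
      (fun θ _ hs => h1 θ hs) (fun θ _ => h2 θ)
  have hA3 : ‖∫ θ in θ₄..2 * π, gK ρ θ * Bq c N b θ‖ ≤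
      Real.exp 1 / 2 * M₁ * (Real.tan (2 * π) - Real.tan θ₄) + 2 * Real.exp 1 / 3 * M₂ * (2 * π - θ₄) :=
    norm_integral_formA hρ hρ1 c N b h45 (fun θ hθ => (hsinpos.trans_le (hcosA3 θ hθ)).ne') hM₁ hM₂
      (fun θ _ hs => h1 θ hs) (fun θ _ => h2 θ)
  have hB1 : ‖∫ θ in θ₁..θ₂, gK ρ θ * Bq c N b θ‖ ≤
      ‖hK ρ θ₂‖ * ‖Bq c N b θ₂‖ + ‖hK ρ θ₁‖ * ‖Bq c N b θ₁‖ + 2 * π * N / c * (θ₂ - θ₁) * M₁' :=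
    norm_integral_formB hρ0 hρ1 c hN b h12 fun θ hθ => h1' θ (hsinB1 θ hθ)
  have hB2 : ‖∫ θ in θ₃..θ₄, gK ρ θ * Bq c N b θ‖ ≤
      ‖hK ρ θ₄‖ * ‖Bq c N b θ₄‖ + ‖hK ρ θ₃‖ * ‖Bq c N b θ₃‖ + 2 * π * N / c * (θ₄ - θ₃) * M₁' :=
    norm_integral_formB hρ0 hρ1 c hN b h34 fun θ hθ => h1' θ (hsinB2 θ hθ)
  -- the splitting
  have hsplit : ∫ θ in (0 : ℝ)..2 * π, gK ρ θ * Bq c N b θ =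
      (∫ θ in (0 : ℝ)..θ₁, gK ρ θ * Bq c N b θ) + (∫ θ in θ₁..θ₂, gK ρ θ * Bq c N b θ) +
        (∫ θ in θ₂..θ₃, gK ρ θ * Bq c N b θ) + (∫ θ in θ₃..θ₄, gK ρ θ * Bq c N b θ) +
        (∫ θ in θ₄..2 * π, gK ρ θ * Bq c N b θ) := by
    rw [intervalIntegral.integral_add_adjacent_intervals (hii _ _) (hii _ _),
      intervalIntegral.integral_add_adjacent_intervals (hii _ _) (hii _ _),
      intervalIntegral.integral_add_adjacent_intervals (hii _ _) (hii _ _),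
      intervalIntegral.integral_add_adjacent_intervals (hii _ _) (hii _ _)]
  -- numerical simplifications
  have htanA : (Real.tan θ₁ - Real.tan 0) + (Real.tan θ₃ - Real.tan θ₂) + (Real.tan (2 * π) - Real.tan θ₄) ≤ 4 * (1 / Δ) := by
    rw [hθ₁, hθ₂, hθ₃, hθ₄, ht3, ht4, ht2π, ht0, tan_pi_div_two_add]
    linarith [hcotΔ]
  have hlenA : (θ₁ - 0) + (θ₃ - θ₂) + (2 * π - θ₄) ≤ 2 * π := by rw [hθ₁, hθ₂, hθ₃, hθ₄]; linarith
  have hlenB : θ₂ - θ₁ = 2 * Δ ∧ θ₄ - θ₃ = 2 * Δ := by rw [hθ₁, hθ₂, hθ₃, hθ₄]; constructor <;> ring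
  have hends : ‖hK ρ θ₂‖ * ‖Bq c N b θ₂‖ + ‖hK ρ θ₁‖ * ‖Bq c N b θ₁‖ +
      (‖hK ρ θ₄‖ * ‖Bq c N b θ₄‖ + ‖hK ρ θ₃‖ * ‖Bq c N b θ₃‖) ≤ 4 * (π / (4 * Δ) * M₁) := by
    have e1 := mul_le_mul (hh_end θ₁ (by simp)) (hB_end θ₁ (by simp)) (norm_nonneg _) (by positivity)
    have e2 := mul_le_mul (hh_end θ₂ (by simp)) (hB_end θ₂ (by simp)) (norm_nonneg _) (by positivity)
    have e3 := mul_le_mul (hh_end θ₃ (by simp)) (hB_end θ₃ (by simp)) (norm_nonneg _) (by positivity)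
    have e4 := mul_le_mul (hh_end θ₄ (by simp)) (hB_end θ₄ (by simp)) (norm_nonneg _) (by positivity)
    linarith
  have hM1e : 0 ≤ Real.exp 1 / 2 * M₁ := by positivity
  have hM2e : 0 ≤ 2 * Real.exp 1 / 3 * M₂ := by positivity
  -- the outer ranges
  have hA : ‖∫ θ in (0 : ℝ)..θ₁, gK ρ θ * Bq c N b θ‖ + ‖∫ θ in θ₂..θ₃, gK ρ θ * Bq c N b θ‖ +
      ‖∫ θ in θ₄..2 * π, gK ρ θ * Bq c N b θ‖ ≤
      Real.exp 1 / 2 * M₁ * (4 * (1 / Δ)) + 2 * Real.exp 1 / 3 * M₂ * (2 * π) := by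
    calc _ ≤ (Real.exp 1 / 2 * M₁ * (Real.tan θ₁ - Real.tan 0) + 2 * Real.exp 1 / 3 * M₂ * (θ₁ - 0)) +
          (Real.exp 1 / 2 * M₁ * (Real.tan θ₃ - Real.tan θ₂) + 2 * Real.exp 1 / 3 * M₂ * (θ₃ - θ₂)) +
          (Real.exp 1 / 2 * M₁ * (Real.tan (2 * π) - Real.tan θ₄) + 2 * Real.exp 1 / 3 * M₂ * (2 * π - θ₄)) :=
          add_le_add (add_le_add hA1 hA2) hA3
      _ = Real.exp 1 / 2 * M₁ * ((Real.tan θ₁ - Real.tan 0) + (Real.tan θ₃ - Real.tan θ₂) + (Real.tan (2 * π) - Real.tan θ₄)) +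
          2 * Real.exp 1 / 3 * M₂ * ((θ₁ - 0) + (θ₃ - θ₂) + (2 * π - θ₄)) := by ring
      _ ≤ _ := add_le_add (mul_le_mul_of_nonneg_left htanA hM1e) (mul_le_mul_of_nonneg_left hlenA hM2e)
  -- the inner ranges
  have hB : ‖∫ θ in θ₁..θ₂, gK ρ θ * Bq c N b θ‖ + ‖∫ θ in θ₃..θ₄, gK ρ θ * Bq c N b θ‖ ≤
      4 * (π / (4 * Δ) * M₁) + 2 * π * N / c * (2 * Δ + 2 * Δ) * M₁' := by
    calc _ ≤ (‖hK ρ θ₂‖ * ‖Bq c N b θ₂‖ + ‖hK ρ θ₁‖ * ‖Bq c N b θ₁‖ + 2 * π * N / c * (θ₂ - θ₁) * M₁') +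
          (‖hK ρ θ₄‖ * ‖Bq c N b θ₄‖ + ‖hK ρ θ₃‖ * ‖Bq c N b θ₃‖ + 2 * π * N / c * (θ₄ - θ₃) * M₁') :=
          add_le_add hB1 hB2
      _ = (‖hK ρ θ₂‖ * ‖Bq c N b θ₂‖ + ‖hK ρ θ₁‖ * ‖Bq c N b θ₁‖ +
            (‖hK ρ θ₄‖ * ‖Bq c N b θ₄‖ + ‖hK ρ θ₃‖ * ‖Bq c N b θ₃‖)) +
          2 * π * N / c * ((θ₂ - θ₁) + (θ₄ - θ₃)) * M₁' := by ring
      _ ≤ _ := by rw [hlenB.1, hlenB.2]; exact add_le_add hends le_rfl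
  rw [hsplit]
  calc ‖(∫ θ in (0 : ℝ)..θ₁, gK ρ θ * Bq c N b θ) + (∫ θ in θ₁..θ₂, gK ρ θ * Bq c N b θ) +
        (∫ θ in θ₂..θ₃, gK ρ θ * Bq c N b θ) + (∫ θ in θ₃..θ₄, gK ρ θ * Bq c N b θ) +
        (∫ θ in θ₄..2 * π, gK ρ θ * Bq c N b θ)‖
      ≤ ‖∫ θ in (0 : ℝ)..θ₁, gK ρ θ * Bq c N b θ‖ + ‖∫ θ in θ₁..θ₂, gK ρ θ * Bq c N b θ‖ +
        ‖∫ θ in θ₂..θ₃, gK ρ θ * Bq c N b θ‖ + ‖∫ θ in θ₃..θ₄, gK ρ θ * Bq c N b θ‖ +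
        ‖∫ θ in θ₄..2 * π, gK ρ θ * Bq c N b θ‖ := by
        refine (norm_add_le _ _).trans (add_le_add ((norm_add_le _ _).trans (add_le_add ((norm_add_le _ _).trans
          (add_le_add ((norm_add_le _ _).trans le_rfl) le_rfl)) le_rfl)) le_rfl)
    _ = (‖∫ θ in (0 : ℝ)..θ₁, gK ρ θ * Bq c N b θ‖ + ‖∫ θ in θ₂..θ₃, gK ρ θ * Bq c N b θ‖ +
          ‖∫ θ in θ₄..2 * π, gK ρ θ * Bq c N b θ‖) +
        (‖∫ θ in θ₁..θ₂, gK ρ θ * Bq c N b θ‖ + ‖∫ θ in θ₃..θ₄, gK ρ θ * Bq c N b θ‖) := by ring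
    _ ≤ (Real.exp 1 / 2 * M₁ * (4 * (1 / Δ)) + 2 * Real.exp 1 / 3 * M₂ * (2 * π)) +
        (4 * (π / (4 * Δ) * M₁) + 2 * π * N / c * (2 * Δ + 2 * Δ) * M₁') := add_le_add hA hB
    _ = _ := by field_simp; ring

/-! ### The bound (5.5) for `F(ρ, c, N, a)` -/

/-- **The input (1.27)** of Proposition 3 (short moduli `c ≤ N`): for the exponent `ε` and the constant
`A`, `‖B(θ, c, N)‖ ≤ A |θ|^{-1/2} c^{1/2} N^{1/2+ε} ‖b‖²` for `0 < |θ| ≤ 2`, `1 ≤ c ≤ N`.  The tree's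
`DeshouillersIwaniec.norm_quadB_le_short` (file `KloostermanQuadraticFormsShort`) provides, for every
`ε > 0`, an `A` with `ShortRange ε A`. [cite: DeshouillersIwaniec1982, Proposition 3 (1.27)] -/
def ShortRange (ε A : ℝ) : Prop :=
  ∀ (θ : ℝ) (c : ℕ) (N : ℝ) (b : ℕ → ℂ), 0 < |θ| → |θ| ≤ 2 → 1 ≤ c → (c : ℝ) ≤ N →
    ‖quadB θ c N b‖ ≤ A * |θ| ^ (-(1 / 2 : ℝ)) * Real.sqrt c * N ^ (1 / 2 + ε) * l2 N b

/-- `‖ā‖² = ‖a‖²`. [folklore] -/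
theorem l2_conj (N : ℝ) (a : ℕ → ℂ) : l2 N (fun n => conj (a n)) = l2 N a := by
  simp [l2]

/-- `s^{-1/2} ≤ 2` for `s ≥ 1/2`. [folklore] -/
theorem rpow_neg_half_le_two {s : ℝ} (hs : 1 / 2 ≤ s) : s ^ (-(1 / 2 : ℝ)) ≤ 2 := by
  have h1 : s ^ (-(1 / 2 : ℝ)) ≤ (1 / 2 : ℝ) ^ (-(1 / 2 : ℝ)) :=
    Real.rpow_le_rpow_of_nonpos (by norm_num) hs (by norm_num)
  have h2 : (1 / 2 : ℝ) ^ (-(1 / 2 : ℝ)) = Real.sqrt 2 := by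
    rw [Real.sqrt_eq_rpow, Real.rpow_neg (by norm_num), ← Real.inv_rpow (by norm_num : (0 : ℝ) ≤ 1 / 2)]
    norm_num
  have h3 : Real.sqrt 2 ≤ 2 := by
    calc Real.sqrt 2 ≤ Real.sqrt (2 ^ 2) := Real.sqrt_le_sqrt (by norm_num)
      _ = 2 := Real.sqrt_sq (by norm_num)
  linarith [h2 ▸ h1]

/-- `‖F‖ = ‖∫₀^{2π} g B‖/(2π)`. [folklore] -/
theorem norm_formE_eq {ρ : ℝ} (hρ : 0 ≤ ρ) (hρ1 : ρ < 1) (c : ℕ) (N : ℝ) (a : ℕ → ℂ) :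
    ‖formE ρ c N a‖ = (2 * π)⁻¹ * ‖∫ θ in (0 : ℝ)..2 * π, gK ρ θ * Bq c N (fun n => conj (a n)) θ‖ := by
  rw [← formE_eq_integral hρ hρ1, norm_mul]
  have : ‖(2 * π : ℂ)‖ = 2 * π := by
    rw [show (2 * π : ℂ) = ((2 * π : ℝ) : ℂ) by push_cast; ring, Complex.norm_real, Real.norm_eq_abs,
      abs_of_pos (by positivity)]
  rw [this, ← mul_assoc, inv_mul_cancel₀ (by positivity), one_mul]

/-- **(5.5), the range `c ≤ N`** ([DeshouillersIwaniec1982, p. 259, `Δ = √(c/N)`]):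
`‖F(ρ, c, N, a)‖ ≤ ((4e + 34π)A/(2π) + 2eQ) N^{1+ε} ‖a‖²`. [cite: DeshouillersIwaniec1982, §5.2 p. 259] -/
theorem norm_formE_le_of_le {ε A : ℝ} (hε : 0 < ε) (hA0 : 0 ≤ A) (hA : ShortRange ε A) {ρ : ℝ}
    (hρ : Real.exp (-1) ≤ ρ) (hρ1 : ρ < 1) {c : ℕ} (hc : 1 ≤ c) {N : ℝ} (hcN : (c : ℝ) ≤ N) (a : ℕ → ℂ) :
    ‖formE ρ c N a‖ ≤ ((4 * Real.exp 1 + 34 * π) * A / (2 * π) + 2 * Real.exp 1 * quadBLSConst) * N ^ (1 + ε) * l2 N a := by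
  have hπ := Real.pi_gt_three
  have hρ0 : 0 ≤ ρ := (Real.exp_pos _).le.trans hρ
  have hc0 : (0 : ℝ) < c := by exact_mod_cast hc
  have hN1 : (1 : ℝ) ≤ N := le_trans (by exact_mod_cast hc) hcN
  have hN : 0 < N := by linarith
  have hQ := quadBLSConst_pos
  set Q := quadBLSConst with hQdef
  set L := l2 N a with hL
  have hL0 : 0 ≤ L := l2_nonneg N a
  set b : ℕ → ℂ := fun n => conj (a n) with hb
  have hlb : l2 N b = L := l2_conj N a
  have hlb' : l2 N (scaleSeq N b) ≤ 2 * L := (l2_scaleSeq_le hN b).trans (by rw [hlb])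
  have hl2s : 0 ≤ l2 N (scaleSeq N b) := l2_nonneg _ _
  -- the sup bounds
  set M₁ : ℝ := 2 * A * Real.sqrt c * N ^ (1 / 2 + ε) * L with hM₁
  have h1 : ∀ θ, 1 / 2 ≤ |Real.sin θ| → ‖Bq c N b θ‖ ≤ M₁ := by
    intro θ hs
    have h := hA (Real.sin θ) c N b (by linarith) ((Real.abs_sin_le_one θ).trans (by norm_num)) hc hcN
    rw [hlb] at h
    refine h.trans ?_
    rw [hM₁]
    have := rpow_neg_half_le_two hs
    have : A * |Real.sin θ| ^ (-(1 / 2 : ℝ)) ≤ 2 * A := by nlinarith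
    gcongr
  have h1' : ∀ θ, 1 / 2 ≤ |Real.sin θ| → ‖Bq c N (scaleSeq N b) θ‖ ≤ 2 * M₁ := by
    intro θ hs
    have h := hA (Real.sin θ) c N (scaleSeq N b) (by linarith) ((Real.abs_sin_le_one θ).trans (by norm_num)) hc hcN
    refine h.trans ?_
    rw [hM₁]
    have := rpow_neg_half_le_two hs
    have h2A : A * |Real.sin θ| ^ (-(1 / 2 : ℝ)) ≤ 2 * A := by nlinarith
    calc A * |Real.sin θ| ^ (-(1 / 2 : ℝ)) * Real.sqrt c * N ^ (1 / 2 + ε) * l2 N (scaleSeq N b)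
        ≤ (2 * A) * Real.sqrt c * N ^ (1 / 2 + ε) * (2 * L) := by gcongr
      _ = _ := by ring
  have h2 : ∀ θ, ‖Bq c N b θ‖ ≤ 3 * Q * N * L := by
    intro θ
    refine (norm_quadB_le_largeSieve (Real.sin θ) hc (by linarith) b).trans ?_
    rw [hlb, ← hQdef]
    have : (c : ℝ) + N + |Real.sin θ| * N ≤ 3 * N := by nlinarith [Real.abs_sin_le_one θ, abs_nonneg (Real.sin θ)]
    calc Q * (c + N + |Real.sin θ| * N) * L ≤ Q * (3 * N) * L := by gcongr
      _ = _ := by ring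
  -- Δ = √(c/N)
  set Δ : ℝ := Real.sqrt c / Real.sqrt N with hΔ
  have hsN : 0 < Real.sqrt N := Real.sqrt_pos.2 hN
  have hsc : 0 < Real.sqrt c := Real.sqrt_pos.2 hc0
  have hΔ0 : 0 < Δ := by positivity
  have hΔ1 : Δ ≤ 1 := by rw [hΔ, div_le_one hsN]; exact Real.sqrt_le_sqrt hcN
  have hmain := norm_integral_two_pi_le hρ hρ1 c hN b hΔ0 hΔ1 (by positivity : 0 ≤ M₁) (by positivity : 0 ≤ 3 * Q * N * L)
    h1 h1' h2
  -- the algebra `M₁/Δ = 2A N^{1+ε} L`, `(N/c) Δ (2M₁) = 4A N^{1+ε} L`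
  have hNpow : Real.sqrt N * N ^ (1 / 2 + ε) = N ^ (1 + ε) := by
    rw [Real.sqrt_eq_rpow, ← Real.rpow_add hN]; ring_nf
  have e1 : M₁ / Δ = 2 * A * N ^ (1 + ε) * L := by
    rw [hM₁, hΔ, ← hNpow]
    field_simp
  have e2 : N / c * Δ * (2 * M₁) = 4 * A * N ^ (1 + ε) * L := by
    rw [hM₁, hΔ, ← hNpow]
    field_simp
    rw [Real.sq_sqrt hc0.le, Real.sq_sqrt hN.le]
    ring
  rw [norm_formE_eq hρ0 hρ1]
  have hNle : N ≤ N ^ (1 + ε) := by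
    calc N = N ^ (1 : ℝ) := (Real.rpow_one N).symm
      _ ≤ N ^ (1 + ε) := Real.rpow_le_rpow_of_exponent_le hN1 (by linarith)
  calc (2 * π)⁻¹ * ‖∫ θ in (0 : ℝ)..2 * π, gK ρ θ * Bq c N b θ‖
      ≤ (2 * π)⁻¹ * (2 * Real.exp 1 * M₁ / Δ + 4 * π * Real.exp 1 / 3 * (3 * Q * N * L) +
          (π * M₁ / Δ + 8 * π * N / c * Δ * (2 * M₁))) := mul_le_mul_of_nonneg_left hmain (by positivity)
    _ = (2 * π)⁻¹ * ((2 * Real.exp 1 + π) * (M₁ / Δ) + 4 * π * Real.exp 1 * Q * (N * L) +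
          8 * π * (N / c * Δ * (2 * M₁))) := by ring
    _ = (2 * π)⁻¹ * ((2 * Real.exp 1 + π) * (2 * A * N ^ (1 + ε) * L) + 4 * π * Real.exp 1 * Q * (N * L) +
          8 * π * (4 * A * N ^ (1 + ε) * L)) := by rw [e1, e2]
    _ ≤ (2 * π)⁻¹ * ((2 * Real.exp 1 + π) * (2 * A * N ^ (1 + ε) * L) + 4 * π * Real.exp 1 * Q * (N ^ (1 + ε) * L) +
          8 * π * (4 * A * N ^ (1 + ε) * L)) := by gcongr
    _ = _ := by field_simp; ring

/-- **(5.5), the range `c > N`** (one integration by parts over the period, then (1.26) resp. (1.25)):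
`‖F‖ ≤ 12πQ N ‖a‖²` if `N < c ≤ N²`, and `‖F‖ ≤ 12π τ(c)² N²/√c ‖a‖²` in general.
[cite: DeshouillersIwaniec1982, §5.2 p. 259] -/
theorem norm_formE_le_of_gt {ρ : ℝ} (hρ : 0 ≤ ρ) (hρ1 : ρ < 1) {c : ℕ} (hc : 1 ≤ c) {N : ℝ} (hN : 1 / 2 ≤ N)
    (hNc : N < c) (a : ℕ → ℂ) :
    ((c : ℝ) ≤ N ^ 2 → ‖formE ρ c N a‖ ≤ 12 * π * quadBLSConst * N * l2 N a) ∧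
      ‖formE ρ c N a‖ ≤ 12 * π * (c.divisors.card : ℝ) ^ 2 * N ^ 2 / Real.sqrt c * l2 N a := by
  have hπ := Real.pi_gt_three
  have hc0 : (0 : ℝ) < c := by exact_mod_cast hc
  have hN0 : 0 < N := by linarith
  have hQ := quadBLSConst_pos
  set Q := quadBLSConst with hQdef
  set L := l2 N a with hL
  have hL0 : 0 ≤ L := l2_nonneg N a
  set b : ℕ → ℂ := fun n => conj (a n) with hb
  have hlb : l2 N b = L := l2_conj N a
  have hlb' : l2 N (scaleSeq N b) ≤ 2 * L := (l2_scaleSeq_le hN0 b).trans (by rw [hlb])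
  have hl2s : 0 ≤ l2 N (scaleSeq N b) := l2_nonneg _ _
  have hsc : 0 < Real.sqrt c := Real.sqrt_pos.2 hc0
  rw [norm_formE_eq hρ hρ1]
  constructor
  · intro hcN2
    have hM : ∀ θ, ‖Bq c N (scaleSeq N b) θ‖ ≤ 6 * Q * c * L := by
      intro θ
      refine (norm_quadB_le_largeSieve (Real.sin θ) hc hN (scaleSeq N b)).trans ?_
      rw [← hQdef]
      have : (c : ℝ) + N + |Real.sin θ| * N ≤ 3 * c := by
        nlinarith [Real.abs_sin_le_one θ, abs_nonneg (Real.sin θ)]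
      calc Q * (c + N + |Real.sin θ| * N) * l2 N (scaleSeq N b) ≤ Q * (3 * c) * (2 * L) := by gcongr
        _ = _ := by ring
    have h := norm_integral_period hρ hρ1 c hN0 b hM
    calc (2 * π)⁻¹ * ‖∫ θ in (0 : ℝ)..2 * π, gK ρ θ * Bq c N b θ‖
        ≤ (2 * π)⁻¹ * (2 * π * N / c * (2 * π) * (6 * Q * c * L)) := mul_le_mul_of_nonneg_left h (by positivity)
      _ = _ := by field_simp; ring
  · have hM : ∀ θ, ‖Bq c N (scaleSeq N b) θ‖ ≤ 6 * (c.divisors.card : ℝ) ^ 2 * Real.sqrt c * N * L := by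
      intro θ
      refine (norm_quadB_le_weil (Real.sin θ) hc hN (scaleSeq N b)).trans ?_
      calc 3 * (c.divisors.card : ℝ) ^ 2 * Real.sqrt c * N * l2 N (scaleSeq N b)
          ≤ 3 * (c.divisors.card : ℝ) ^ 2 * Real.sqrt c * N * (2 * L) := by gcongr
        _ = _ := by ring
    have h := norm_integral_period hρ hρ1 c hN0 b hM
    obtain ⟨sc, hscdef⟩ : ∃ sc : ℝ, sc = Real.sqrt c := ⟨_, rfl⟩
    have hsc0 : 0 < sc := by rw [hscdef]; exact hsc
    have hc' : (c : ℝ) = sc ^ 2 := by rw [hscdef, Real.sq_sqrt hc0.le]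
    rw [← hscdef] at h ⊢
    rw [hc'] at h
    clear hc' hscdef hM hsc
    calc (2 * π)⁻¹ * ‖∫ θ in (0 : ℝ)..2 * π, gK ρ θ * Bq c N b θ‖
        ≤ (2 * π)⁻¹ * (2 * π * N / sc ^ 2 * (2 * π) * (6 * (c.divisors.card : ℝ) ^ 2 * sc * N * L)) :=
          mul_le_mul_of_nonneg_left h (by positivity)
      _ = _ := by
          field_simp
          ring

/-- **(5.5)** ([DeshouillersIwaniec1982, p. 258]: "`F_𝔞(c, N) ≪ c^{−ε} N^{1+5ε} ‖a_N‖²`"): for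
`0 < ε ≤ 1/12` and an input `ShortRange ε A` there is `C = C(ε, A)` with
`‖F(ρ, c, N, a)‖ ≤ C c^{−ε} N^{1+6ε} ‖a‖²` for all `e⁻¹ ≤ ρ < 1`, `c ≥ 1`, `N ≥ 1/2` (the three ranges
`c ≤ N`, `N < c ≤ N²`, `c > N²`, the divisor bound `τ(c) ≤ C_τ c^ε` in the last).
[cite: DeshouillersIwaniec1982, §5.2 (5.5)] -/
theorem norm_formE_le {ε A : ℝ} (hε : 0 < ε) (hε1 : ε ≤ 1 / 12) (hA0 : 0 ≤ A) (hA : ShortRange ε A) :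
    ∃ C : ℝ, 0 ≤ C ∧ ∀ (ρ : ℝ) (c : ℕ) (N : ℝ) (a : ℕ → ℂ), Real.exp (-1) ≤ ρ → ρ < 1 → 1 ≤ c → 1 / 2 ≤ N →
      ‖formE ρ c N a‖ ≤ C * (c : ℝ) ^ (-ε) * N ^ (1 + 6 * ε) * l2 N a := by
  obtain ⟨Cτ, hCτ1, hCτ⟩ := exists_card_divisors_le_mul_rpow hε
  have hQ := quadBLSConst_pos
  have hπ := Real.pi_pos
  obtain ⟨CA, hCA⟩ : ∃ CA : ℝ, CA = (4 * Real.exp 1 + 34 * π) * A / (2 * π) + 2 * Real.exp 1 * quadBLSConst := ⟨_, rfl⟩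
  have hCA0 : 0 ≤ CA := by rw [hCA]; positivity
  set Ctot : ℝ := CA + 12 * π * quadBLSConst + 12 * π * Cτ ^ 2 with hCtot
  refine ⟨Ctot, by positivity, ?_⟩
  intro ρ c N a hρ hρ1 hc hN
  have hρ0 : 0 ≤ ρ := (Real.exp_pos _).le.trans hρ
  have hc0 : (0 : ℝ) < c := by exact_mod_cast hc
  have hN0 : 0 < N := by linarith
  have hL := l2_nonneg N a
  obtain ⟨X, hX⟩ : ∃ X : ℝ, X = (c : ℝ) ^ (-ε) * N ^ (1 + 6 * ε) * l2 N a := ⟨_, rfl⟩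
  have hX0 : 0 ≤ X := by rw [hX]; positivity
  have hsuff : ∀ K : ℝ, K ≤ Ctot → ‖formE ρ c N a‖ ≤ K * X →
      ‖formE ρ c N a‖ ≤ Ctot * (c : ℝ) ^ (-ε) * N ^ (1 + 6 * ε) * l2 N a := by
    intro K hK h
    calc ‖formE ρ c N a‖ ≤ K * X := h
      _ ≤ Ctot * X := mul_le_mul_of_nonneg_right hK hX0
      _ = _ := by rw [hX]; ring
  have hK1 : CA ≤ Ctot := by rw [hCtot]; nlinarith [sq_nonneg Cτ]
  have hK2 : 12 * π * quadBLSConst ≤ Ctot := by rw [hCtot]; nlinarith [sq_nonneg Cτ]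
  have hK3 : 12 * π * Cτ ^ 2 ≤ Ctot := by rw [hCtot]; nlinarith
  rcases le_or_gt (c : ℝ) N with hcN | hcN
  · -- the range `c ≤ N`
    have hN1 : (1 : ℝ) ≤ N := le_trans (by exact_mod_cast hc) hcN
    refine hsuff CA hK1 ?_
    have h := norm_formE_le_of_le hε hA0 hA hρ hρ1 hc hcN a
    rw [← hCA] at h
    refine h.trans ?_
    have key : N ^ (1 + ε) ≤ (c : ℝ) ^ (-ε) * N ^ (1 + 6 * ε) := by
      have h1 : N ^ (-ε) ≤ (c : ℝ) ^ (-ε) := Real.rpow_le_rpow_of_nonpos hc0 hcN (by linarith)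
      have h2 : N ^ (-ε) * N ^ (1 + 6 * ε) = N ^ (1 + 5 * ε) := by rw [← Real.rpow_add hN0]; ring_nf
      have h3 : N ^ (1 + ε) ≤ N ^ (1 + 5 * ε) := Real.rpow_le_rpow_of_exponent_le hN1 (by linarith)
      calc N ^ (1 + ε) ≤ N ^ (1 + 5 * ε) := h3
        _ = N ^ (-ε) * N ^ (1 + 6 * ε) := h2.symm
        _ ≤ (c : ℝ) ^ (-ε) * N ^ (1 + 6 * ε) := mul_le_mul_of_nonneg_right h1 (by positivity)
    rw [hX]
    calc CA * N ^ (1 + ε) * l2 N a ≤ CA * ((c : ℝ) ^ (-ε) * N ^ (1 + 6 * ε)) * l2 N a := by gcongr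
      _ = _ := by ring
  · obtain ⟨hB1, hB2⟩ := norm_formE_le_of_gt hρ0 hρ1 hc hN hcN a
    rcases le_or_gt (c : ℝ) (N ^ 2) with hcN2 | hcN2
    · -- the range `N < c ≤ N²`
      refine hsuff (12 * π * quadBLSConst) hK2 ?_
      refine (hB1 hcN2).trans ?_
      have hN1 : (1 : ℝ) ≤ N := by
        by_contra h
        push Not at h
        nlinarith [mul_pos hN0 (sub_pos.2 h), hcN.trans_le hcN2]
      have key : N ≤ (c : ℝ) ^ (-ε) * N ^ (1 + 6 * ε) := by
        have h1 : (N ^ 2) ^ (-ε) ≤ (c : ℝ) ^ (-ε) := Real.rpow_le_rpow_of_nonpos (by positivity) hcN2 (by linarith)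
        have h2 : (N ^ 2) ^ (-ε) * N ^ (1 + 6 * ε) = N ^ (1 + 4 * ε) := by
          rw [← Real.rpow_natCast N 2, ← Real.rpow_mul hN0.le, ← Real.rpow_add hN0]
          push_cast
          ring_nf
        have h3 : N ≤ N ^ (1 + 4 * ε) := by
          calc N = N ^ (1 : ℝ) := (Real.rpow_one N).symm
            _ ≤ N ^ (1 + 4 * ε) := Real.rpow_le_rpow_of_exponent_le hN1 (by linarith)
        calc N ≤ N ^ (1 + 4 * ε) := h3
          _ = (N ^ 2) ^ (-ε) * N ^ (1 + 6 * ε) := h2.symm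
          _ ≤ _ := mul_le_mul_of_nonneg_right h1 (by positivity)
      rw [hX]
      calc 12 * π * quadBLSConst * N * l2 N a ≤ 12 * π * quadBLSConst * ((c : ℝ) ^ (-ε) * N ^ (1 + 6 * ε)) * l2 N a := by
            gcongr
        _ = _ := by ring
    · -- the range `c > N²`
      refine hsuff (12 * π * Cτ ^ 2) hK3 ?_
      refine hB2.trans ?_
      have hτ : (c.divisors.card : ℝ) ≤ Cτ * (c : ℝ) ^ ε := hCτ c (by omega)
      have hτ2 : (c.divisors.card : ℝ) ^ 2 ≤ Cτ ^ 2 * (c : ℝ) ^ (2 * ε) := by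
        calc (c.divisors.card : ℝ) ^ 2 ≤ (Cτ * (c : ℝ) ^ ε) ^ 2 := pow_le_pow_left₀ (by positivity) hτ 2
          _ = Cτ ^ 2 * ((c : ℝ) ^ ε) ^ 2 := by ring
          _ = _ := by rw [← Real.rpow_natCast ((c : ℝ) ^ ε) 2, ← Real.rpow_mul hc0.le]; push_cast; ring_nf
      have key : (c : ℝ) ^ (2 * ε) * N ^ 2 / Real.sqrt c ≤ (c : ℝ) ^ (-ε) * N ^ (1 + 6 * ε) := by
        have e1 : (c : ℝ) ^ (2 * ε) / Real.sqrt c = (c : ℝ) ^ (-ε) * (c : ℝ) ^ (3 * ε - 1 / 2) := by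
          rw [Real.sqrt_eq_rpow, div_eq_mul_inv, ← Real.rpow_neg hc0.le, ← Real.rpow_add hc0, ← Real.rpow_add hc0]
          ring_nf
        have e2 : (c : ℝ) ^ (3 * ε - 1 / 2) ≤ (N ^ 2) ^ (3 * ε - 1 / 2) :=
          Real.rpow_le_rpow_of_nonpos (by positivity) hcN2.le (by linarith)
        have e3 : (N ^ 2) ^ (3 * ε - 1 / 2) * N ^ 2 = N ^ (1 + 6 * ε) := by
          rw [← Real.rpow_natCast N 2, ← Real.rpow_mul hN0.le, ← Real.rpow_add hN0]
          push_cast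
          ring_nf
        calc (c : ℝ) ^ (2 * ε) * N ^ 2 / Real.sqrt c = ((c : ℝ) ^ (2 * ε) / Real.sqrt c) * N ^ 2 := by ring
          _ = (c : ℝ) ^ (-ε) * ((c : ℝ) ^ (3 * ε - 1 / 2) * N ^ 2) := by rw [e1]; ring
          _ ≤ (c : ℝ) ^ (-ε) * ((N ^ 2) ^ (3 * ε - 1 / 2) * N ^ 2) := by gcongr
          _ = _ := by rw [e3]
      rw [hX]
      calc 12 * π * (c.divisors.card : ℝ) ^ 2 * N ^ 2 / Real.sqrt c * l2 N a
          ≤ 12 * π * (Cτ ^ 2 * (c : ℝ) ^ (2 * ε)) * N ^ 2 / Real.sqrt c * l2 N a := by gcongr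
        _ = 12 * π * Cτ ^ 2 * ((c : ℝ) ^ (2 * ε) * N ^ 2 / Real.sqrt c) * l2 N a := by ring
        _ ≤ 12 * π * Cτ ^ 2 * ((c : ℝ) ^ (-ε) * N ^ (1 + 6 * ε)) * l2 N a := by gcongr
        _ = _ := by ring

/-! ### Petersson's formula (the hypothesis) and the Kloosterman side -/

/-- `|J_n(x)| ≤ e|x|/2` for `n ≥ 1` (from `|J_n(x)| ≤ |x/2|ⁿ e^{|x/2|²}/n!` for `|x| ≤ 2` and `|J_n| ≤ 1`).
[folklore] -/
theorem abs_besselJ_le_mul {n : ℕ} (hn : 1 ≤ n) (x : ℝ) : |besselJ n x| ≤ Real.exp 1 * |x| / 2 := by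
  by_cases hx : |x / 2| ≤ 1
  · have h := abs_besselJ_le_pow_div_factorial n x
    have h1 : |x / 2| ^ n ≤ |x / 2| := by
      calc |x / 2| ^ n ≤ |x / 2| ^ 1 := pow_le_pow_of_le_one (abs_nonneg _) hx hn
        _ = |x / 2| := pow_one _
    have h2 : Real.exp (|x / 2| ^ 2) ≤ Real.exp 1 := Real.exp_le_exp.2 (by nlinarith [abs_nonneg (x / 2)])
    have h3 : (1 : ℝ) ≤ (n.factorial : ℝ) := by exact_mod_cast Nat.one_le_iff_ne_zero.2 (Nat.factorial_ne_zero n)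
    calc |besselJ n x| ≤ |x / 2| ^ n / (n.factorial : ℝ) * Real.exp (|x / 2| ^ 2) := h
      _ ≤ |x / 2| / 1 * Real.exp 1 := by gcongr
      _ = Real.exp 1 * |x| / 2 := by rw [abs_div, abs_two]; ring
  · push Not at hx
    have h1 := abs_besselJ_le_one_holds n x
    have h2 : (1 : ℝ) ≤ Real.exp 1 := Real.one_le_exp (by norm_num)
    rw [abs_div, abs_two] at hx
    nlinarith

/-- The `c`-th term of the KLOOSTERMAN SIDE of Petersson's formula at level `r` and weight `k`:
`[1 ≤ c, r ∣ c] · c⁻¹ S(m, n; c) J_{k−1}(4π√(mn)/c)` (classical Kloosterman sum, the tree's `besselJ`).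
[cite: DeshouillersIwaniec1982, (4.4) p. 249] -/
def petTerm (r k m n c : ℕ) : ℂ :=
  if 1 ≤ c ∧ r ∣ c then ((c : ℂ))⁻¹ * kloo m n c * (besselJ (k - 1) (4 * π * Real.sqrt ((m : ℝ) * n) / c) : ℂ) else 0

/-- A summable majorant of the Kloosterman side, uniform in the weight: `2πe √(mn) √m τ(c) c^{−3/2}`
(Weil's bound and `|J_{k−1}(x)| ≤ ex/2`). [folklore] -/
def petMaj (m n c : ℕ) : ℝ :=
  2 * π * Real.exp 1 * Real.sqrt ((m : ℝ) * n) * Real.sqrt m * (c.divisors.card : ℝ) * (c : ℝ) ^ (-(3 / 2 : ℝ))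

/-- `petMaj ≥ 0`. [folklore] -/
theorem petMaj_nonneg (m n c : ℕ) : 0 ≤ petMaj m n c := by unfold petMaj; positivity

/-- **`‖petTerm‖ ≤ petMaj`** for `k ≥ 2`. [folklore] -/
theorem norm_petTerm_le (r : ℕ) {k : ℕ} (hk : 2 ≤ k) (m n c : ℕ) : ‖petTerm r k m n c‖ ≤ petMaj m n c := by
  -- `m = 0`: the Bessel factor is `J_{k−1}(0) = 0`
  rcases Nat.eq_zero_or_pos m with hm | hm
  · subst hm
    have hJ0 : besselJ (k - 1) (4 * π * Real.sqrt (((0 : ℕ) : ℝ) * n) / c) = 0 := by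
      obtain ⟨j, hj⟩ : ∃ j, k - 1 = j + 1 := ⟨k - 2, by omega⟩
      rw [hj]
      simp [besselJ_succ_apply_zero]
    unfold petTerm
    rw [hJ0]
    simp [petMaj_nonneg]
  unfold petTerm
  split_ifs with h
  · obtain ⟨hc, _⟩ := h
    have hc0 : (0 : ℝ) < c := by exact_mod_cast hc
    have hsc : 0 < Real.sqrt c := Real.sqrt_pos.2 hc0
    have hW := norm_kloo_le m n (c := c) hc
    have hJ := abs_besselJ_le_mul (n := k - 1) (by omega) (4 * π * Real.sqrt ((m : ℝ) * n) / c)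
    have hgcd : Real.sqrt (Int.gcd m c : ℝ) ≤ Real.sqrt m := by
      refine Real.sqrt_le_sqrt ?_
      have : Int.gcd (m : ℤ) (c : ℤ) ≤ m := by
        rw [Int.gcd_natCast_natCast]; exact Nat.le_of_dvd hm (Nat.gcd_dvd_left _ _)
      exact_mod_cast this
    rw [norm_mul, norm_mul, norm_inv, Complex.norm_natCast, Complex.norm_real, Real.norm_eq_abs]
    rw [abs_div, abs_of_nonneg (by positivity : 0 ≤ 4 * π * Real.sqrt ((m : ℝ) * n)), Nat.abs_cast] at hJ
    have hrpow : (c : ℝ) ^ (-(3 / 2 : ℝ)) = (c : ℝ)⁻¹ * (Real.sqrt c / c) := by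
      have h32 : (c : ℝ) ^ ((3 : ℝ) / 2) = c * Real.sqrt c := by
        rw [show (3 : ℝ) / 2 = 1 + 1 / 2 by norm_num, Real.rpow_add hc0, Real.rpow_one, Real.sqrt_eq_rpow]
      have hsq : Real.sqrt (c : ℝ) / c = (Real.sqrt c)⁻¹ := by
        rw [div_eq_iff hc0.ne', inv_mul_eq_div, eq_div_iff hsc.ne', Real.mul_self_sqrt hc0.le]
      rw [Real.rpow_neg hc0.le, h32, mul_inv, hsq]
    unfold petMaj
    rw [hrpow]
    calc (c : ℝ)⁻¹ * ‖kloo m n c‖ * |besselJ (k - 1) (4 * π * Real.sqrt ((m : ℝ) * n) / c)|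
        ≤ (c : ℝ)⁻¹ * ((c.divisors.card : ℝ) * Real.sqrt c * Real.sqrt m) *
          (Real.exp 1 * (4 * π * Real.sqrt ((m : ℝ) * n) / c) / 2) := by
          refine mul_le_mul (mul_le_mul_of_nonneg_left (hW.trans (by gcongr)) (by positivity)) hJ (abs_nonneg _)
            (by positivity)
      _ = _ := by ring
  · rw [norm_zero]; exact petMaj_nonneg m n c

/-- `petMaj m n` is summable in `c` (`τ(c) ≤ C c^{1/4}`, `∑ c^{−5/4} < ∞`). [folklore] -/
theorem summable_petMaj (m n : ℕ) : Summable (petMaj m n) := by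
  obtain ⟨Cτ, hC1, hCτ⟩ := exists_card_divisors_le_mul_rpow' (ε := 1 / 4) (by norm_num)
  have hs : Summable fun c : ℕ => ((c : ℝ) ^ (5 / 4 : ℝ))⁻¹ := Real.summable_nat_rpow_inv.2 (by norm_num)
  refine Summable.of_nonneg_of_le (fun c => petMaj_nonneg m n c) (fun c => ?_)
    ((hs.mul_left (2 * π * Real.exp 1 * Real.sqrt ((m : ℝ) * n) * Real.sqrt m * Cτ)))
  unfold petMaj
  rcases Nat.eq_zero_or_pos c with hc | hc
  · subst hc
    simp [Real.zero_rpow (by norm_num : (-(3 / 2 : ℝ)) ≠ 0), Real.zero_rpow (by norm_num : (5 / 4 : ℝ) ≠ 0)]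
  · have hc0 : (0 : ℝ) < c := by exact_mod_cast hc
    have h1 := hCτ c
    have h2 : (c : ℝ) ^ (1 / 4 : ℝ) * (c : ℝ) ^ (-(3 / 2 : ℝ)) = ((c : ℝ) ^ (5 / 4 : ℝ))⁻¹ := by
      rw [← Real.rpow_add hc0, ← Real.rpow_neg hc0.le]; norm_num
    calc 2 * π * Real.exp 1 * Real.sqrt ((m : ℝ) * n) * Real.sqrt m * (c.divisors.card : ℝ) * (c : ℝ) ^ (-(3 / 2 : ℝ))
        ≤ 2 * π * Real.exp 1 * Real.sqrt ((m : ℝ) * n) * Real.sqrt m * (Cτ * (c : ℝ) ^ (1 / 4 : ℝ)) * (c : ℝ) ^ (-(3 / 2 : ℝ)) := by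
          gcongr
      _ = _ := by rw [← h2]; ring

/-- The Kloosterman side of Petersson's formula converges absolutely for `k ≥ 2`. [folklore] -/
theorem summable_petTerm (r : ℕ) {k : ℕ} (hk : 2 ≤ k) (m n : ℕ) : Summable (petTerm r k m n) :=
  Summable.of_norm_bounded (summable_petMaj m n) (norm_petTerm_le r hk m n)

/-- `‖∑_c petTerm‖ ≤ ∑_c petMaj` (a bound uniform in the weight). [folklore] -/
theorem norm_tsum_petTerm_le (r : ℕ) {k : ℕ} (hk : 2 ≤ k) (m n : ℕ) :
    ‖∑' c, petTerm r k m n c‖ ≤ ∑' c, petMaj m n c :=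
  tsum_of_norm_bounded (summable_petMaj m n).hasSum (norm_petTerm_le r hk m n)

/-- **Hypothesis: Petersson's formula** for an abstract family of holomorphic cusp forms of level `r`
about one cusp — an index type `ι` with weights `wt` and normalised coefficients `P f n` (for the
cusp `∞` resp. `0` of `Γ₀(r)`: the arrays `PH`, resp. `QH`, of the tree's `BFI.L1.SpecData`, i.e.
`√n ρ_{f𝔞}(n)` in the normalisation of [Drappeau2017, (4.5)]): (i) every weight is even and `≥ 2`
(odd weights and `k < 2` carry no cusp forms on `Γ₀(r)`), and (ii) for even `k ≥ 2` and `m, n ≥ 1`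
the orthogonality relation [DeshouillersIwaniec1982, (4.4) with `𝔞 = 𝔟`, `e(b_{𝔞𝔞}n) = 1`], in the
tree's normalisation,

  `4π Γ(k−1) ∑_{wt f = k} conj(P f m) P f n = δ_{mn} + 2π i^k ∑_{c ≥ 1, r ∣ c} c⁻¹ S(m, n; c) J_{k−1}(4π√(mn)/c)`

(the sum over the fibre as a `HasSum`, the Kloosterman series being absolutely convergent by
`summable_petTerm`; for `𝔞 = ∞` and for `𝔞 = 0` with Iwaniec's scaling `σ₀ = (0, −1/√r; √r, 0)` the
Kloosterman sums `S_{𝔞𝔞}(m, n; c)` of `Γ₀(r)` are the classical ones with `c ≡ 0 (mod r)`).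
[cite: DeshouillersIwaniec1982, (4.4) p. 249; Drappeau2017, §4.1.2 (4.5)] -/
def PeterssonFamily (ι : Type*) (wt : ι → ℕ) (P : ι → ℕ → ℂ) (r : ℕ) : Prop :=
  (∀ f, Even (wt f) ∧ 2 ≤ wt f) ∧
  ∀ k m n : ℕ, 2 ≤ k → Even k → 1 ≤ m → 1 ≤ n →
    HasSum (fun f : {f : ι // wt f = k} => conj (P f.1 m) * P f.1 n)
      ((((4 * π * Real.Gamma ((k : ℝ) - 1) : ℝ)) : ℂ)⁻¹ *
        ((if m = n then 1 else 0) + 2 * π * I ^ k * ∑' c : ℕ, petTerm r k m n c))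

/-! ### The fibre of one weight: `∑_{wt f = k} |∑ a_n P f n|²` from Petersson's formula -/

/-- The Kloosterman side paired with `ā_m a_n`: `𝒯_k = ∑_{m,n ∼ N} ā_m a_n ∑_c petTerm r k m n c`. [folklore] -/
def Tk (r k : ℕ) (N : ℝ) (a : ℕ → ℂ) : ℂ :=
  ∑ m ∈ dyadic N, ∑ n ∈ dyadic N, conj (a m) * a n * ∑' c : ℕ, petTerm r k m n c

/-- `Y_k = Re(‖a‖² + 2π i^k 𝒯_k)` (`= 4πΓ(k−1) ∑_{wt f = k} |∑ a_n P f n|² ≥ 0`). [folklore] -/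
def Yk (r k : ℕ) (N : ℝ) (a : ℕ → ℂ) : ℝ := ((l2 N a : ℂ) + 2 * π * I ^ k * Tk r k N a).re

/-- `|∑_n a_n P_f(n)|² = ∑_{m,n} ā_m a_n conj(P_f(m)) P_f(n)` (as complex numbers). [folklore] -/
theorem normSq_sum_eq (D : Finset ℕ) (a : ℕ → ℂ) (Pf : ℕ → ℂ) :
    (((‖∑ n ∈ D, a n * Pf n‖ ^ 2 : ℝ)) : ℂ) = ∑ m ∈ D, ∑ n ∈ D, conj (a m) * a n * (conj (Pf m) * Pf n) := by
  rw [← Complex.normSq_eq_norm_sq, Complex.normSq_eq_conj_mul_self, map_sum, Finset.sum_mul_sum]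
  refine Finset.sum_congr rfl fun m _ => Finset.sum_congr rfl fun n _ => ?_
  rw [map_mul]
  ring

/-- `∑_{m,n ∼ N} ā_m a_n δ_{mn} = ‖a‖²`. [folklore] -/
theorem sum_sum_ite_eq_l2 (N : ℝ) (a : ℕ → ℂ) :
    ∑ m ∈ dyadic N, ∑ n ∈ dyadic N, conj (a m) * a n * (if m = n then (1 : ℂ) else 0) = (l2 N a : ℂ) := by
  rw [l2]
  push_cast
  refine Finset.sum_congr rfl fun m hm => ?_
  simp_rw [mul_ite, mul_one, mul_zero]
  rw [Finset.sum_ite_eq, if_pos hm, Complex.conj_mul']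

/-- **The fibre bound** ([DeshouillersIwaniec1982, p. 258: "multiplying (4.4) by `ā_m a_n` and
summing over `m, n`"]): for even `k ≥ 2` and a finite family `G` of forms of weight `k`,
`∑_{f ∈ G} |∑_n a_n P f n|² ≤ (4πΓ(k−1))⁻¹ Y_k`, and `Y_k ≥ 0`. [cite: DeshouillersIwaniec1982, §5.2 p. 258] -/
theorem sum_fibre_le {ι : Type*} {wt : ι → ℕ} {P : ι → ℕ → ℂ} {r : ℕ} (hP : PeterssonFamily ι wt P r)
    {k : ℕ} (hk : 2 ≤ k) (hke : Even k) {N : ℝ} (hN : 0 ≤ N) (a : ℕ → ℂ) (G : Finset ι) (hG : ∀ f ∈ G, wt f = k) :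
    ∑ f ∈ G, ‖∑ n ∈ dyadic N, a n * P f n‖ ^ 2 ≤ (4 * π * Real.Gamma ((k : ℝ) - 1))⁻¹ * Yk r k N a ∧
      0 ≤ Yk r k N a := by
  -- the `HasSum` over the fibre of `|∑ a P|²`
  have hfib : HasSum (fun f : {f : ι // wt f = k} => ((‖∑ n ∈ dyadic N, a n * P f.1 n‖ ^ 2 : ℝ) : ℂ))
      ((((4 * π * Real.Gamma ((k : ℝ) - 1) : ℝ)) : ℂ)⁻¹ * ((l2 N a : ℂ) + 2 * π * I ^ k * Tk r k N a)) := by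
    have h := hasSum_sum (s := dyadic N) fun m hm => hasSum_sum (s := dyadic N) fun n hn =>
      (hP.2 k m n hk hke (pos_of_mem_dyadic hN hm) (pos_of_mem_dyadic hN hn)).mul_left (conj (a m) * a n)
    have hfun : (fun f : {f : ι // wt f = k} => ((‖∑ n ∈ dyadic N, a n * P f.1 n‖ ^ 2 : ℝ) : ℂ)) =
        fun f => ∑ m ∈ dyadic N, ∑ n ∈ dyadic N, conj (a m) * a n * (conj (P f.1 m) * P f.1 n) :=
      funext fun f => normSq_sum_eq _ _ _
    have hv : ∑ m ∈ dyadic N, ∑ n ∈ dyadic N, conj (a m) * a n *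
        ((((4 * π * Real.Gamma ((k : ℝ) - 1) : ℝ)) : ℂ)⁻¹ *
          ((if m = n then 1 else 0) + 2 * π * I ^ k * ∑' c : ℕ, petTerm r k m n c)) =
        (((4 * π * Real.Gamma ((k : ℝ) - 1) : ℝ)) : ℂ)⁻¹ * ((l2 N a : ℂ) + 2 * π * I ^ k * Tk r k N a) := by
      rw [Tk, ← sum_sum_ite_eq_l2, Finset.mul_sum, mul_add, Finset.mul_sum, Finset.mul_sum, ← Finset.sum_add_distrib]
      refine Finset.sum_congr rfl fun m _ => ?_
      rw [Finset.mul_sum, Finset.mul_sum, Finset.mul_sum, ← Finset.sum_add_distrib]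
      refine Finset.sum_congr rfl fun n _ => ?_
      ring
    rw [hfun, ← hv]
    exact h
  -- real parts
  have hre := Complex.hasSum_re hfib
  simp only [Complex.ofReal_re] at hre
  have hval : ((((4 * π * Real.Gamma ((k : ℝ) - 1) : ℝ)) : ℂ)⁻¹ * ((l2 N a : ℂ) + 2 * π * I ^ k * Tk r k N a)).re =
      (4 * π * Real.Gamma ((k : ℝ) - 1))⁻¹ * Yk r k N a := by
    rw [← Complex.ofReal_inv, Complex.re_ofReal_mul, Yk]
  rw [hval] at hre
  have hΓ : 0 < 4 * π * Real.Gamma ((k : ℝ) - 1) := by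
    have : 0 < Real.Gamma ((k : ℝ) - 1) := Real.Gamma_pos_of_pos (by
      have : (2 : ℝ) ≤ k := by exact_mod_cast hk
      linarith)
    positivity
  constructor
  · have h := sum_le_hasSum (G.subtype fun f => wt f = k) (fun f _ => sq_nonneg _) hre
    rw [Finset.sum_subtype_eq_sum_filter (f := fun f => ‖∑ n ∈ dyadic N, a n * P f n‖ ^ 2)] at h
    rwa [Finset.filter_true_of_mem hG] at h
  · have h := sum_le_hasSum (∅ : Finset {f : ι // wt f = k}) (fun f _ => sq_nonneg _) hre
    rw [Finset.sum_empty] at h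
    exact (mul_nonneg_iff_of_pos_left (inv_pos.2 hΓ)).1 h

/-! ### Summing Petersson's formula over the weights against `(k−1)ρ^{k−1}` ([DeshouillersIwaniec1982, (5.3)]) -/

/-- The complex weights `w_l = (2l+1)(−1)^{l+1} ρ^{2l+1}` (`k = 2l + 2`, `i^k = (−1)^{l+1}`). [folklore] -/
def wK (ρ : ℝ) (l : ℕ) : ℂ := ((2 * l + 1 : ℕ) : ℂ) * (-1) ^ (l + 1) * (ρ : ℂ) ^ (2 * l + 1)

/-- `‖w_l‖ = (2l+1)ρ^{2l+1}`. [folklore] -/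
theorem norm_wK {ρ : ℝ} (hρ : 0 ≤ ρ) (l : ℕ) : ‖wK ρ l‖ = ((2 * l + 1 : ℕ) : ℝ) * ρ ^ (2 * l + 1) := by
  rw [wK, norm_mul, norm_mul, norm_pow, norm_neg, norm_one, one_pow, mul_one, Complex.norm_natCast, norm_pow,
    Complex.norm_real, Real.norm_eq_abs, abs_of_nonneg hρ]

/-- `i^{2l+2} = (−1)^{l+1}`, so `(2l+1)ρ^{2l+1} i^{2l+2} = w_l`. [folklore] -/
theorem ofReal_mul_I_pow (ρ : ℝ) (l : ℕ) :
    (((((2 * l + 1 : ℕ) : ℝ) * ρ ^ (2 * l + 1) : ℝ)) : ℂ) * I ^ (2 * l + 2) = wK ρ l := by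
  rw [wK, show 2 * l + 2 = 2 * (l + 1) by ring, pow_mul, Complex.I_sq]
  push_cast
  ring

/-- The double family `(l, c) ↦ w_l · petTerm r (2l+2) m n c` is absolutely summable. [folklore] -/
theorem summable_wK_petTerm {ρ : ℝ} (hρ : 0 ≤ ρ) (hρ1 : ρ < 1) (r m n : ℕ) :
    Summable (Function.uncurry fun l c : ℕ => wK ρ l * petTerm r (2 * l + 2) m n c) := by
  have h1 : Summable fun l : ℕ => ‖(((2 * l + 1 : ℕ) : ℝ) * ρ ^ (2 * l + 1) : ℝ)‖ :=
    (tsum_DK_le hρ hρ1).1.congr fun l => (Real.norm_of_nonneg (by positivity)).symm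
  have h2 : Summable fun c : ℕ => ‖petMaj m n c‖ :=
    (summable_petMaj m n).congr fun c => (Real.norm_of_nonneg (petMaj_nonneg m n c)).symm
  have hprod := summable_mul_of_summable_norm h1 h2
  refine Summable.of_norm_bounded hprod fun p => ?_
  rw [Function.uncurry, norm_mul, norm_wK hρ]
  exact mul_le_mul_of_nonneg_left (norm_petTerm_le r (by omega) m n p.2) (by positivity)

/-- **The Neumann series appears**: `∑_l w_l petTerm r (2l+2) m n c = [1 ≤ c, r ∣ c] c⁻¹ S(m,n;c) E(ρ, 4π√(mn)/c)`.
[cite: DeshouillersIwaniec1982, §5.2 (5.3)] -/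
theorem tsum_wK_petTerm {ρ : ℝ} (hρ : 0 ≤ ρ) (hρ1 : ρ < 1) (r m n c : ℕ) :
    ∑' l : ℕ, wK ρ l * petTerm r (2 * l + 2) m n c =
      if 1 ≤ c ∧ r ∣ c then ((c : ℂ))⁻¹ * kloo m n c * (besselE ρ (4 * π * Real.sqrt ((m : ℝ) * n) / c) : ℂ) else 0 := by
  by_cases h : 1 ≤ c ∧ r ∣ c
  · rw [if_pos h]
    have hs := (Complex.hasSum_ofReal.2 (hasSum_besselE hρ hρ1 (4 * π * Real.sqrt ((m : ℝ) * n) / c))).mul_left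
      (((c : ℂ))⁻¹ * kloo m n c)
    have hfun : (fun l : ℕ => wK ρ l * petTerm r (2 * l + 2) m n c) = fun l : ℕ => ((c : ℂ))⁻¹ * kloo m n c *
        (((((2 * l + 1 : ℕ) : ℝ) * (-1) ^ (l + 1) * ρ ^ (2 * l + 1) * besselJ (2 * l + 1) (4 * π * Real.sqrt ((m : ℝ) * n) / c) : ℝ)) : ℂ) := by
      funext l
      rw [petTerm, if_pos h, show 2 * l + 2 - 1 = 2 * l + 1 by omega, wK]
      push_cast
      ring
    rw [hfun]
    exact hs.tsum_eq
  · rw [if_neg h]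
    have : ∀ l : ℕ, wK ρ l * petTerm r (2 * l + 2) m n c = 0 := fun l => by rw [petTerm, if_neg h, mul_zero]
    simp [this]

/-- **Interchanging the weights with the Kloosterman side** ([DeshouillersIwaniec1982, p. 258, (5.3)]):
`∑_l w_l 𝒯_{2l+2} = ∑_{c ≥ 1, r ∣ c} c⁻¹ F(ρ, c, N, a)`, all series converging absolutely.
[cite: DeshouillersIwaniec1982, §5.2 (5.3)] -/
theorem tsum_wK_Tk {ρ : ℝ} (hρ : 0 ≤ ρ) (hρ1 : ρ < 1) (r : ℕ) (N : ℝ) (a : ℕ → ℂ) :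
    Summable (fun l : ℕ => wK ρ l * Tk r (2 * l + 2) N a) ∧
      Summable (fun c : ℕ => if 1 ≤ c ∧ r ∣ c then ((c : ℂ))⁻¹ * formE ρ c N a else 0) ∧
      ∑' l : ℕ, wK ρ l * Tk r (2 * l + 2) N a = ∑' c : ℕ, (if 1 ≤ c ∧ r ∣ c then ((c : ℂ))⁻¹ * formE ρ c N a else 0) := by
  -- the `(m, n)`-terms
  set H : ℕ → ℕ → ℕ → ℂ := fun m n l => ∑' c : ℕ, wK ρ l * petTerm r (2 * l + 2) m n c with hH
  set V : ℕ → ℕ → ℕ → ℂ := fun m n c => if 1 ≤ c ∧ r ∣ c then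
    ((c : ℂ))⁻¹ * kloo m n c * (besselE ρ (4 * π * Real.sqrt ((m : ℝ) * n) / c) : ℂ) else 0 with hV
  have hS := fun m n => summable_wK_petTerm hρ hρ1 r m n
  have hHs : ∀ m n, Summable (H m n) := fun m n => (hS m n).prod
  have hVs : ∀ m n, Summable (V m n) := by
    intro m n
    have h := (hS m n).prod_symm.prod
    refine h.congr fun c => ?_
    simp only [Prod.swap]
    exact tsum_wK_petTerm hρ hρ1 r m n c
  have hHV : ∀ m n, ∑' l, H m n l = ∑' c, V m n c := by
    intro m n
    simp only [hH, hV]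
    rw [← (hS m n).tsum_comm]
    exact tsum_congr fun c => tsum_wK_petTerm hρ hρ1 r m n c
  -- `w_l 𝒯_{2l+2} = ∑_{m,n} ā_m a_n H_{mn}(l)`
  have hTk : ∀ l, wK ρ l * Tk r (2 * l + 2) N a = ∑ m ∈ dyadic N, ∑ n ∈ dyadic N, conj (a m) * a n * H m n l := by
    intro l
    rw [Tk, Finset.mul_sum]
    refine Finset.sum_congr rfl fun m _ => ?_
    rw [Finset.mul_sum]
    refine Finset.sum_congr rfl fun n _ => ?_
    simp only [hH]
    rw [tsum_mul_left]
    ring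
  have hsum1 : Summable fun l : ℕ => wK ρ l * Tk r (2 * l + 2) N a := by
    simp_rw [hTk]
    exact summable_sum fun m _ => summable_sum fun n _ => (hHs m n).mul_left _
  -- `[..] c⁻¹ F(c) = ∑_{m,n} ā_m a_n V_{mn}(c)`
  have hF : ∀ c, (if 1 ≤ c ∧ r ∣ c then ((c : ℂ))⁻¹ * formE ρ c N a else 0) =
      ∑ m ∈ dyadic N, ∑ n ∈ dyadic N, conj (a m) * a n * V m n c := by
    intro c
    simp only [hV]
    split_ifs with hc
    · rw [formE, Finset.mul_sum]
      refine Finset.sum_congr rfl fun m _ => ?_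
      rw [Finset.mul_sum]
      refine Finset.sum_congr rfl fun n _ => ?_
      ring
    · simp
  have hsum2 : Summable fun c : ℕ => (if 1 ≤ c ∧ r ∣ c then ((c : ℂ))⁻¹ * formE ρ c N a else 0) := by
    simp_rw [hF]
    exact summable_sum fun m _ => summable_sum fun n _ => (hVs m n).mul_left _
  refine ⟨hsum1, hsum2, ?_⟩
  simp_rw [hTk, hF]
  rw [Summable.tsum_finsetSum fun m _ => summable_sum fun n _ => (hHs m n).mul_left _,
    Summable.tsum_finsetSum fun m _ => summable_sum fun n _ => (hVs m n).mul_left _]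
  refine Finset.sum_congr rfl fun m _ => ?_
  rw [Summable.tsum_finsetSum fun n _ => (hHs m n).mul_left _, Summable.tsum_finsetSum fun n _ => (hVs m n).mul_left _]
  refine Finset.sum_congr rfl fun n _ => ?_
  rw [tsum_mul_left, tsum_mul_left, hHV]

/-- **The weighted series of the fibre bounds**: with `v_l = (2l+1)ρ^{2l+1}`,
`∑_l v_l Y_{2l+2} = D(ρ) ‖a‖² + 2π Re ∑_{c ≥ 1, r ∣ c} c⁻¹ F(ρ, c, N, a)` ([DeshouillersIwaniec1982, (5.3)]:
"`D_K ‖a_N‖² + π ∑_c c⁻¹ ∑ ā_m a_n S(n, m; c) E_K(4π√(mn)/c)`"). [cite: DeshouillersIwaniec1982, §5.2 (5.3)–(5.4)] -/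
theorem hasSum_weight_Yk {ρ : ℝ} (hρ : 0 ≤ ρ) (hρ1 : ρ < 1) (r : ℕ) (N : ℝ) (a : ℕ → ℂ) :
    HasSum (fun l : ℕ => ((2 * l + 1 : ℕ) : ℝ) * ρ ^ (2 * l + 1) * Yk r (2 * l + 2) N a)
      (ρ * (1 + ρ ^ 2) / (1 - ρ ^ 2) ^ 2 * l2 N a +
        2 * π * (∑' c : ℕ, (if 1 ≤ c ∧ r ∣ c then ((c : ℂ))⁻¹ * formE ρ c N a else 0)).re) := by
  obtain ⟨hs1, _, heq⟩ := tsum_wK_Tk hρ hρ1 r N a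
  have h1 : HasSum (fun l : ℕ => ((2 * l + 1 : ℕ) : ℝ) * ρ ^ (2 * l + 1) * l2 N a)
      (ρ * (1 + ρ ^ 2) / (1 - ρ ^ 2) ^ 2 * l2 N a) := (hasSum_DK hρ hρ1).mul_right _
  have h2 : HasSum (fun l : ℕ => (2 * π * (wK ρ l * Tk r (2 * l + 2) N a)).re)
      (2 * π * (∑' c : ℕ, (if 1 ≤ c ∧ r ∣ c then ((c : ℂ))⁻¹ * formE ρ c N a else 0)).re) := by
    have h := Complex.hasSum_re ((hs1.hasSum).mul_left (2 * π : ℂ))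
    rw [heq] at h
    convert h using 1
    rw [show (2 * π : ℂ) = ((2 * π : ℝ) : ℂ) by push_cast; ring, Complex.re_ofReal_mul]
  have hfun : (fun l : ℕ => ((2 * l + 1 : ℕ) : ℝ) * ρ ^ (2 * l + 1) * Yk r (2 * l + 2) N a) =
      fun l : ℕ => ((2 * l + 1 : ℕ) : ℝ) * ρ ^ (2 * l + 1) * l2 N a + (2 * π * (wK ρ l * Tk r (2 * l + 2) N a)).re := by
    funext l
    rw [Yk, Complex.add_re, Complex.ofReal_re, mul_add]
    congr 1
    rw [← Complex.re_ofReal_mul]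
    congr 1
    rw [← ofReal_mul_I_pow]
    push_cast
    ring
  rw [hfun]
  exact h1.add h2

/-- **The level sum**: `∑_{c ≥ 1, r ∣ c} c^{-(1+ε)} = r^{-(1+ε)} ζ(1+ε) ≤ r⁻¹ ∑_j j^{-(1+ε)}`. [folklore] -/
theorem tsum_level_le {ε : ℝ} (hε : 0 < ε) {r : ℕ} (hr : 1 ≤ r) :
    Summable (fun c : ℕ => if 1 ≤ c ∧ r ∣ c then (c : ℝ) ^ (-(1 + ε)) else 0) ∧
      ∑' c : ℕ, (if 1 ≤ c ∧ r ∣ c then (c : ℝ) ^ (-(1 + ε)) else 0) ≤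
        (r : ℝ)⁻¹ * ∑' j : ℕ, (j : ℝ) ^ (-(1 + ε)) := by
  have hr0 : (0 : ℝ) < r := by exact_mod_cast hr
  have hζ : Summable fun j : ℕ => (j : ℝ) ^ (-(1 + ε)) := Real.summable_nat_rpow.2 (by linarith)
  set f : ℕ → ℝ := fun c => if 1 ≤ c ∧ r ∣ c then (c : ℝ) ^ (-(1 + ε)) else 0 with hf
  have hinj : Function.Injective fun j : ℕ => r * j := fun x y h => by
    simpa [Nat.mul_right_inj (by omega : r ≠ 0)] using h
  have hsupp : Function.support f ⊆ Set.range fun j : ℕ => r * j := by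
    intro c hc
    rw [Function.mem_support] at hc
    simp only [hf] at hc
    split_ifs at hc with h
    · obtain ⟨j, hj⟩ := h.2
      exact ⟨j, hj.symm⟩
    · exact (hc rfl).elim
  have hcomp : ∀ j : ℕ, f (r * j) = (r : ℝ) ^ (-(1 + ε)) * (j : ℝ) ^ (-(1 + ε)) := by
    intro j
    rcases Nat.eq_zero_or_pos j with rfl | hj
    · have h0 : ((0 : ℕ) : ℝ) ^ (-(1 + ε)) = 0 := by rw [Nat.cast_zero]; exact Real.zero_rpow (by linarith)
      rw [h0, mul_zero, hf]
      simp
    · rw [hf]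
      simp only
      rw [if_pos ⟨Nat.one_le_iff_ne_zero.2 (Nat.mul_ne_zero (by omega) (by omega)), dvd_mul_right r j⟩]
      push_cast
      exact Real.mul_rpow hr0.le (Nat.cast_nonneg _)
  have heq : ∑' c, f c = ∑' j, f (r * j) := (hinj.tsum_eq hsupp).symm
  have hsupp' : ∀ x ∉ Set.range (fun j : ℕ => r * j), f x = 0 := fun x hx => by
    by_contra h
    exact hx (hsupp (Function.mem_support.2 h))
  have hsf : Summable f := by
    have : Summable fun j => f (r * j) := by
      simp_rw [hcomp]; exact hζ.mul_left _
    exact (hinj.summable_iff hsupp').1 this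
  refine ⟨hsf, ?_⟩
  rw [heq]
  simp_rw [hcomp]
  rw [tsum_mul_left]
  refine mul_le_mul_of_nonneg_right ?_ (tsum_nonneg fun j => by positivity)
  rw [← Real.rpow_neg_one]
  exact Real.rpow_le_rpow_of_exponent_le (by exact_mod_cast hr) (by linarith)

/-! ### Theorem 2 (1.28) -/

/-- **The large sieve inequality for a Petersson family** ([DeshouillersIwaniec1982, Theorem 2 (1.28)],
through Proposition 4 (5.2)): for `0 < ε ≤ 1/12` and an input `ShortRange ε A` (Proposition 3 (1.27))
there is `K = K(ε, A)` such that for EVERY family `(ι, wt, P)` satisfying Petersson's formula at a level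
`r ≥ 1`, all `T ≥ 1`, `N ≥ 1/2`, all `a` and all finite sets `F` of forms of weight `≤ T`,

  `∑_{f ∈ F} Γ(wt f) |∑_{N<n≤2N} a_n P f n|² ≤ K (T² + N^{1+6ε}/r) ‖a‖²`.

(Proof: `Γ(k) ≤ e ρ^{k−1} Γ(k)` for `k ≤ T`, `ρ = e^{−1/T}`; the fibre bound; the weighted series
`∑ (2l+1)ρ^{2l+1} Y_{2l+2} = D(ρ)‖a‖² + 2π Re ∑_{r∣c} c⁻¹F(c)` with `D(ρ) ≤ (9/2)T²` and, by (5.5),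
`|∑_{r ∣ c} c⁻¹ F(c)| ≤ C ζ(1+ε) N^{1+6ε} ‖a‖²/r`.) [cite: DeshouillersIwaniec1982, Theorem 2 (1.28), Proposition 4 (5.2)] -/
theorem largeSieve_hol_of_petersson {ε A : ℝ} (hε : 0 < ε) (hε1 : ε ≤ 1 / 12) (hA0 : 0 ≤ A) (hA : ShortRange ε A) :
    ∃ K : ℝ, 0 ≤ K ∧ ∀ (ι : Type*) (wt : ι → ℕ) (P : ι → ℕ → ℂ) (r : ℕ), 1 ≤ r → PeterssonFamily ι wt P r →
      ∀ (T N : ℝ), 1 ≤ T → 1 / 2 ≤ N → ∀ (a : ℕ → ℂ) (F : Finset ι), (∀ f ∈ F, (wt f : ℝ) ≤ T) →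
        ∑ f ∈ F, Real.Gamma (wt f) * ‖∑ n ∈ dyadic N, a n * P f n‖ ^ 2 ≤
          K * (T ^ 2 + N ^ (1 + 6 * ε) / r) * l2 N a := by
  obtain ⟨C, hC0, hC⟩ := norm_formE_le hε hε1 hA0 hA
  have hζs : Summable fun j : ℕ => (j : ℝ) ^ (-(1 + ε)) := Real.summable_nat_rpow.2 (by linarith)
  obtain ⟨ζ, hζ⟩ : ∃ ζ : ℝ, ζ = ∑' j : ℕ, (j : ℝ) ^ (-(1 + ε)) := ⟨_, rfl⟩
  have hζ0 : 0 ≤ ζ := by rw [hζ]; exact tsum_nonneg fun j => by positivity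
  refine ⟨2 + 2 * C * ζ, by positivity, ?_⟩
  intro ι wt P r hr hP T N hT hN a F hF
  have hπ := Real.pi_gt_three
  have hN0 : 0 ≤ N := by linarith
  have hT0 : 0 < T := by linarith
  have hr0 : (0 : ℝ) < r := by exact_mod_cast hr
  have hL := l2_nonneg N a
  -- `ρ = e^{-1/T}`
  obtain ⟨ρ, hρdef⟩ : ∃ ρ : ℝ, ρ = Real.exp (-1 / T) := ⟨_, rfl⟩
  have hρ1 : ρ < 1 := by
    rw [hρdef, Real.exp_lt_one_iff]
    exact div_neg_of_neg_of_pos (by norm_num) hT0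
  have hρe : Real.exp (-1) ≤ ρ := by
    rw [hρdef, Real.exp_le_exp, le_div_iff₀ hT0]
    linarith
  have hρ0 : 0 ≤ ρ := by rw [hρdef]; exact (Real.exp_pos _).le
  -- the fibres `wt f = 2l + 2`
  obtain ⟨g, hg⟩ : ∃ g : ι → ℕ, g = fun f => wt f / 2 - 1 := ⟨_, rfl⟩
  obtain ⟨Lb, hLb⟩ : ∃ Lb : ℕ, Lb = ⌊T⌋₊ + 1 := ⟨_, rfl⟩
  have hwt : ∀ f, wt f = 2 * g f + 2 := by
    intro f
    obtain ⟨he, h2⟩ := hP.1 f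
    obtain ⟨j, hj⟩ := he
    rw [hg]
    simp only
    omega
  have hmaps : ∀ f ∈ F, g f ∈ Finset.range Lb := by
    intro f hf
    rw [Finset.mem_range, hLb]
    have hfl : wt f ≤ ⌊T⌋₊ := Nat.le_floor (hF f hf)
    have := hwt f
    omega
  rw [← Finset.sum_fiberwise_of_maps_to hmaps]
  -- Step 1: each fibre
  have hY0 : ∀ l, 0 ≤ Yk r (2 * l + 2) N a := fun l =>
    (sum_fibre_le hP (by omega : 2 ≤ 2 * l + 2) ⟨l + 1, by ring⟩ hN0 a ∅ (fun f hf => by simp at hf)).2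
  have hfib : ∀ l ∈ Finset.range Lb,
      ∑ f ∈ F with g f = l, Real.Gamma (wt f) * ‖∑ n ∈ dyadic N, a n * P f n‖ ^ 2 ≤
        Real.exp 1 / (4 * π) * (((2 * l + 1 : ℕ) : ℝ) * ρ ^ (2 * l + 1) * Yk r (2 * l + 2) N a) := by
    intro l _
    have hk2 : 2 ≤ 2 * l + 2 := by omega
    have hke : Even (2 * l + 2) := ⟨l + 1, by ring⟩
    obtain ⟨hle, _⟩ := sum_fibre_le hP hk2 hke hN0 a (F.filter fun f => g f = l)
      (fun f hf => by rw [Finset.mem_filter] at hf; rw [hwt f, hf.2])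
    have hs1 : (0 : ℝ) < ((2 * l + 2 : ℕ) : ℝ) - 1 := by push_cast; linarith
    have hΓ1 : 0 < Real.Gamma (((2 * l + 2 : ℕ) : ℝ) - 1) := Real.Gamma_pos_of_pos hs1
    have hΓ : Real.Gamma ((2 * l + 2 : ℕ) : ℝ) = (2 * l + 1) * Real.Gamma (((2 * l + 2 : ℕ) : ℝ) - 1) := by
      have h := Real.Gamma_add_one (s := ((2 * l + 2 : ℕ) : ℝ) - 1) hs1.ne'
      rw [sub_add_cancel] at h
      rw [h]
      push_cast
      ring
    have hsum : ∑ f ∈ F with g f = l, Real.Gamma (wt f) * ‖∑ n ∈ dyadic N, a n * P f n‖ ^ 2 =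
        Real.Gamma ((2 * l + 2 : ℕ) : ℝ) * ∑ f ∈ F with g f = l, ‖∑ n ∈ dyadic N, a n * P f n‖ ^ 2 := by
      rw [Finset.mul_sum]
      refine Finset.sum_congr rfl fun f hf => ?_
      rw [Finset.mem_filter] at hf
      rw [hwt f, hf.2]
    rw [hsum]
    by_cases hem : (F.filter fun f => g f = l) = ∅
    · rw [hem, Finset.sum_empty, mul_zero]
      have := hY0 l
      positivity
    · obtain ⟨f₀, hf₀⟩ := Finset.nonempty_of_ne_empty hem
      rw [Finset.mem_filter] at hf₀
      have hlT : (2 * (l : ℝ) + 1) + 1 ≤ T := by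
        have h := hF f₀ hf₀.1
        rw [hwt f₀, hf₀.2] at h
        push_cast at h
        linarith
      have hρpow : 1 ≤ Real.exp 1 * ρ ^ (2 * l + 1) := by
        rw [hρdef, ← Real.exp_nat_mul, ← Real.exp_add]
        refine Real.one_le_exp ?_
        have h1 : ((2 * l + 1 : ℕ) : ℝ) * (-1 / T) = -(((2 * l + 1 : ℕ) : ℝ) / T) := by ring
        rw [h1, ← sub_eq_add_neg, sub_nonneg, div_le_one hT0]
        push_cast
        linarith
      have hΓ0 : 0 ≤ Real.Gamma ((2 * l + 2 : ℕ) : ℝ) := by rw [hΓ]; positivity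
      have hYl := hY0 l
      calc Real.Gamma ((2 * l + 2 : ℕ) : ℝ) * ∑ f ∈ F with g f = l, ‖∑ n ∈ dyadic N, a n * P f n‖ ^ 2
          ≤ Real.Gamma ((2 * l + 2 : ℕ) : ℝ) * ((4 * π * Real.Gamma (((2 * l + 2 : ℕ) : ℝ) - 1))⁻¹ * Yk r (2 * l + 2) N a) :=
            mul_le_mul_of_nonneg_left hle hΓ0
        _ = (2 * l + 1) / (4 * π) * Yk r (2 * l + 2) N a := by
            rw [hΓ]
            field_simp
        _ ≤ (Real.exp 1 * ρ ^ (2 * l + 1)) * ((2 * l + 1) / (4 * π) * Yk r (2 * l + 2) N a) :=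
            le_mul_of_one_le_left (by positivity) hρpow
        _ = _ := by push_cast; ring
  -- Step 2: the sum over the weights against the full series
  have hstep2 : ∑ l ∈ Finset.range Lb, ∑ f ∈ F with g f = l, Real.Gamma (wt f) * ‖∑ n ∈ dyadic N, a n * P f n‖ ^ 2 ≤
      Real.exp 1 / (4 * π) * (ρ * (1 + ρ ^ 2) / (1 - ρ ^ 2) ^ 2 * l2 N a +
        2 * π * (∑' c : ℕ, (if 1 ≤ c ∧ r ∣ c then ((c : ℂ))⁻¹ * formE ρ c N a else 0)).re) := by
    calc _ ≤ ∑ l ∈ Finset.range Lb, Real.exp 1 / (4 * π) * (((2 * l + 1 : ℕ) : ℝ) * ρ ^ (2 * l + 1) * Yk r (2 * l + 2) N a) :=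
          Finset.sum_le_sum hfib
      _ = Real.exp 1 / (4 * π) * ∑ l ∈ Finset.range Lb, ((2 * l + 1 : ℕ) : ℝ) * ρ ^ (2 * l + 1) * Yk r (2 * l + 2) N a := by
          rw [Finset.mul_sum]
      _ ≤ _ := by
          refine mul_le_mul_of_nonneg_left ?_ (by positivity)
          exact sum_le_hasSum _ (fun l _ => mul_nonneg (by positivity) (hY0 l)) (hasSum_weight_Yk hρ0 hρ1 r N a)
  -- Step 3: the Kloosterman side, summed over the level, by (5.5)
  obtain ⟨_, hsumF, _⟩ := tsum_wK_Tk hρ0 hρ1 r N a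
  obtain ⟨hls, hlv⟩ := tsum_level_le hε hr
  have hre : (∑' c : ℕ, (if 1 ≤ c ∧ r ∣ c then ((c : ℂ))⁻¹ * formE ρ c N a else 0)).re ≤
      C * ζ * N ^ (1 + 6 * ε) * l2 N a / r := by
    refine (Complex.re_le_norm _).trans ((norm_tsum_le_tsum_norm hsumF.norm).trans ?_)
    have hterm : ∀ c : ℕ, ‖(if 1 ≤ c ∧ r ∣ c then ((c : ℂ))⁻¹ * formE ρ c N a else 0)‖ ≤
        C * N ^ (1 + 6 * ε) * l2 N a * (if 1 ≤ c ∧ r ∣ c then (c : ℝ) ^ (-(1 + ε)) else 0) := by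
      intro c
      split_ifs with hc
      · have hc0 : (0 : ℝ) < c := by exact_mod_cast hc.1
        rw [norm_mul, norm_inv, Complex.norm_natCast]
        have h := hC ρ c N a hρe hρ1 hc.1 hN
        have hexp : (c : ℝ)⁻¹ * (c : ℝ) ^ (-ε) = (c : ℝ) ^ (-(1 + ε)) := by
          rw [← Real.rpow_neg_one, ← Real.rpow_add hc0]; ring_nf
        calc (c : ℝ)⁻¹ * ‖formE ρ c N a‖ ≤ (c : ℝ)⁻¹ * (C * (c : ℝ) ^ (-ε) * N ^ (1 + 6 * ε) * l2 N a) := by gcongr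
          _ = C * N ^ (1 + 6 * ε) * l2 N a * ((c : ℝ)⁻¹ * (c : ℝ) ^ (-ε)) := by ring
          _ = _ := by rw [hexp]
      · simp
    calc ∑' c : ℕ, ‖(if 1 ≤ c ∧ r ∣ c then ((c : ℂ))⁻¹ * formE ρ c N a else 0)‖
        ≤ ∑' c : ℕ, C * N ^ (1 + 6 * ε) * l2 N a * (if 1 ≤ c ∧ r ∣ c then (c : ℝ) ^ (-(1 + ε)) else 0) :=
          hsumF.norm.tsum_le_tsum hterm (hls.mul_left _)
      _ = C * N ^ (1 + 6 * ε) * l2 N a * ∑' c : ℕ, (if 1 ≤ c ∧ r ∣ c then (c : ℝ) ^ (-(1 + ε)) else 0) := tsum_mul_left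
      _ ≤ C * N ^ (1 + 6 * ε) * l2 N a * ((r : ℝ)⁻¹ * ζ) := by
          rw [hζ]; exact mul_le_mul_of_nonneg_left hlv (by positivity)
      _ = _ := by ring
  -- Step 4: `D(ρ) ≤ (9/2) T²`
  have hD : ρ * (1 + ρ ^ 2) / (1 - ρ ^ 2) ^ 2 ≤ 9 / 2 * T ^ 2 := by
    have h1 : ρ * (1 + ρ ^ 2) / (1 - ρ ^ 2) ^ 2 ≤ 2 / (1 - ρ ^ 2) ^ 2 := by
      rw [← (hasSum_DK hρ0 hρ1).tsum_eq]; exact (tsum_DK_le hρ0 hρ1).2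
    have h2 : 1 / (1 - ρ ^ 2) ≤ 3 * T / 2 := by rw [hρdef]; exact inv_one_sub_sq_exp_le hT
    have h3 : 0 < 1 - ρ ^ 2 := by nlinarith
    have h4 : 0 ≤ 1 / (1 - ρ ^ 2) := by positivity
    calc ρ * (1 + ρ ^ 2) / (1 - ρ ^ 2) ^ 2 ≤ 2 / (1 - ρ ^ 2) ^ 2 := h1
      _ = 2 * (1 / (1 - ρ ^ 2)) ^ 2 := by field_simp
      _ ≤ 2 * (3 * T / 2) ^ 2 := by gcongr
      _ = 9 / 2 * T ^ 2 := by ring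
  -- combine
  have hNr : 0 ≤ N ^ (1 + 6 * ε) / r := by positivity
  calc _ ≤ Real.exp 1 / (4 * π) * (ρ * (1 + ρ ^ 2) / (1 - ρ ^ 2) ^ 2 * l2 N a +
        2 * π * (∑' c : ℕ, (if 1 ≤ c ∧ r ∣ c then ((c : ℂ))⁻¹ * formE ρ c N a else 0)).re) := hstep2
    _ ≤ Real.exp 1 / (4 * π) * (9 / 2 * T ^ 2 * l2 N a + 2 * π * (C * ζ * N ^ (1 + 6 * ε) * l2 N a / r)) := by
        gcongr
    _ = (9 * Real.exp 1 / (8 * π)) * (T ^ 2 * l2 N a) + (Real.exp 1 / 2 * C * ζ) * (N ^ (1 + 6 * ε) / r * l2 N a) := by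
        field_simp
        ring
    _ ≤ 2 * (T ^ 2 * l2 N a) + (2 * C * ζ) * (N ^ (1 + 6 * ε) / r * l2 N a) := by
        have he : Real.exp 1 ≤ 3 := le_of_lt (lt_trans Real.exp_one_lt_d9 (by norm_num))
        have h1 : 9 * Real.exp 1 / (8 * π) ≤ 2 := by
          rw [div_le_iff₀ (by positivity)]; nlinarith
        have h2 : Real.exp 1 / 2 * C * ζ ≤ 2 * C * ζ := by
          have hCζ : 0 ≤ C * ζ := mul_nonneg hC0 hζ0
          nlinarith
        have hT2 : 0 ≤ T ^ 2 * l2 N a := by positivity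
        have hX : 0 ≤ N ^ (1 + 6 * ε) / r * l2 N a := by positivity
        exact add_le_add (mul_le_mul_of_nonneg_right h1 hT2) (mul_le_mul_of_nonneg_right h2 hX)
    _ ≤ (2 + 2 * C * ζ) * (T ^ 2 + N ^ (1 + 6 * ε) / r) * l2 N a := by
        have hCζ : 0 ≤ C * ζ := mul_nonneg hC0 hζ0
        nlinarith [mul_nonneg hCζ (mul_nonneg (sq_nonneg T) hL), mul_nonneg hNr hL]


end DeshouillersIwaniec

end Literature.NumberTheory.Sieve
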